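import Mathlib.Analysis.SpecialFunctions.SmoothTransition
import Mathlib.Analysis.SpecialFunctions.Gaussian.GaussianIntegral
import Mathlib.Analysis.Complex.ExponentialBounds
import Literature.Barriers.NavierStokesRegularity.CriticalDataSmoothNonuniquenessConstruction
import Literature.Analysis.FluidPDE.AnomalousDissipationProofs
import Literature.MathematicalPhysics.QuantumLattice.SchwartzFourierDensity
import Literature.Analysis.FluidPDE.ClassicalNSKatoUniqueness
import HarnessLib

/-!
# Refutation of `CoiculescuPalasek2025_perturbation`: a forced shear flow that is an approximate
  solution in the sense of Coiculescu–Palasek, and the Kato-class uniqueness argument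

Barrier-side proof file (D-0021/D-0026: no new named fact; the definitions below are the explicit
objects of ONE counterexample, each with proved API) attached to
`Literature/Barriers/NavierStokesRegularity/CriticalDataSmoothNonuniquenessConstruction.lean`, whose
named fact `CoiculescuPalasek2025_perturbation` vendors Props. 4.2–4.3 (with App. B and §5 ¶1) of
M. P. Coiculescu, S. Palasek, *Non-uniqueness of smooth solutions of the Navier–Stokes equations from
critical data*, Invent. Math. 244 (2025) = arXiv:2503.14699, as an ABSTRACT perturbation theorem:
for EVERY `α ∈ (0, 1/8)`, EVERY Hölder exponent `κ ∈ (0, 1/2 - 4α)` and all constants `K, C`, there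
is `C₄` such that for all `ε₁ < C₄⁻¹` some `ε₀, η` make EVERY approximate solution `(v, F, π)`
(`CoiculescuPalasek2025.IsApproximateSolution`: eq. (4.1), (3.13a), (3.13b) with slope `η`, `‖F‖_Y ≤ ε₀`)
correctable by some `w ∈ B_X(0, ε₁)` to a smooth solution of (NSE) with `w(t) → 0`.

**This file proves `¬ CoiculescuPalasek2025_perturbation`** (`not_CoiculescuPalasek2025_perturbation`).

## Why the abstraction fails (and what the paper proves)

Prop. 4.2 as stated (p. 18 of the arXiv version) bounds
`‖S(t,t')a‖_∞ + (t-t')^{1/2}‖∇S(t,t')a‖_{C^κ} ≲ (t')^{-1+α-ε} t^{-1/2+ε} ‖a‖_Y`; its printed proof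
(p. 19) establishes the `∇`-slot only with the weight `t^{-(1+κ)/2}` — the Grönwall argument is run
for `h(t) = (t-t')^{1/2} t^{(1+κ)/2} ‖∇S(t,t')‖_{C^κ}` — and already the free term
`I = e^{(t-t')Δ}ℙ div a(t')` saturates that weight (single mode at frequency `N` with
`N^{1+κ} = (t')^{-1/2}`). With the proved weight, the fixed point of Prop. 4.3 closes in `X`
(weight `t^{1-α/2}` on `‖∇·‖_{C^κ}`) iff `κ ≤ α`. For the paper this is immaterial: `κ` is at the
authors' disposal in `(0, 1/2 - 1/(2γ) - 2α)` and may be taken `≤ α` (only upper bounds on `κ` are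
used elsewhere), so Thm. 1.2 stands. The vendored fact, however, quantifies over all
`κ < 1/2 - 4α`, and for `κ(1-2α) > α` it is false, as the following family shows.

## The counterexample (`α = 1/16`, `κ = 1/5`)

Time profile: `ρ(x) = smoothTransition(x-1)` (`Shear.bump`), `|ρ'| ≤ R` (`Shear.exists_bumpDeriv_le`);
`a(t) = -2πN A₀ ρ(t/s₀) e^{-4π²N²t}` (`Shear.amp`), `g(t) = 2πN A₀ s₀⁻¹ ρ'(t/s₀) e^{-4π²N²t}`
(`Shear.src`), so that `a' = -4π²N² a - g` (`Shear.ampDeriv_eq`). Space profile: the shear mode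
`P_N(x) = (sin 2πN x₁, 0, cos 2πN x₁) = Re (e_{N e₁}(x) (-i, 0, 1))` of
`Literature.Analysis.FluidPDE.PulsedShear.profile` (`AnomalousDissipationProofs`: `div P_N = 0`,
`(P_N·∇)P_N = 0`, `ΔP_N = -4π²N² P_N`) and the symmetric tensor potential
`Φ_N = Re (e_{N e₁} M)`, `M = [[0,-1,0],[-1,0,-i],[0,-i,0]]/(2πN)` (`Shear.tpot`), with
`div (c Φ_N) = c P_N` (`Shear.matrixDiv_smul_tpot`). Fields: `v(t) = a(t) P_N` (`Shear.vel`),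
`F(t) = g(t) Φ_N` (`Shear.res`), `π = 0`. Then (4.1) holds EXACTLY in the classical form of
`IsApproximateSolution.solution` (`Shear.isClassicalNSSolutionOn_vel`), and
(`Shear.isApproximateSolution`): (3.13a) with `K m = 6 (m+1)!` for `A₀ ≤ 1`
(`‖Dᵐ(v∘proj)‖ ≤ 2|a|(2πN)ᵐ` from the character bounds of
`Literature.MathematicalPhysics.QuantumLattice.norm_iteratedFDeriv_eChar_le`, and
`(2πN)^{m+1}e^{-4π²N²t} ≤ 3(m+1)! t^{-(m+1)/2}`); (3.13b) with `C = 6` and any slope `η ≥ 0`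
(`∫ (4πNA₀E)² + s^{-1/2}4πNA₀E ≤ 2A₀² + 2√πA₀`, Mathlib's Gamma integral); `∫ v = 0`; and
`‖F‖_Y ≤ A₀ R s₀^{-α}(2 + 200 s₀^{1/2} N^{1+κ})` (`F = 0` off `[s₀, 2s₀]`; `‖Φ_N‖ ≤ (2πN)⁻¹`;
`[DΦ_N∘proj]_κ ≤ (2π+2)N^κ` by interpolation at scale `N⁻¹`,
`Literature.Analysis.FunctionSpaces.holderWith_of_lipschitzWith_of_edist_le`).

Refutation (`not_CoiculescuPalasek2025_perturbation`): with `s₀ = N^{-12/5}`, `A₀ = δ N^{-3/20}`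
(`A₀ s₀^{-α} = δ`, `s₀^{1/2}N^{6/5} = 1`), `δ = min(10⁻³, ε₀/(400R))`, `ε₁ = min(C₄⁻¹/2, 1/40)` and
`N` large, a correction `w` as claimed would make `u = v + w` a mean-zero classical solution of the
unforced equations on `(0, T_*]` in the Kato class `‖u(t)‖_∞ ≤ (14δ + ε₁) t^{-15/32}` with weakly
vanishing datum (`v ≡ 0` on `(0, s₀]`, clause (e)); by
`Torus.IsClassicalNSSolutionOn.eq_zero_of_kato_of_pairing` (`ClassicalNSKatoUniqueness`) `u ≡ 0`, so
`w(t_*) = -v(t_*)` at `t_* = (2πN)^{-2}`, where clause (d), `t_*^{1-α/2}[∇w(t_*)]_κ ≤ ε₁`, meets the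
lower bound `t_*^{31/32} |a(t_*)| 4πN(2N)^{1/5} ≥ c₀ δ N^{9/80}` (`9/80 = κ(1-2α) - α`;
`Shear.le_eHolderNorm_iteratedFDeriv_one_lift_vel`: compare `D(v∘proj)` along `e₁` at `0` and at
`(2N)⁻¹e₁`), which exceeds `1 > ε₁` for `N` large.

## Corrected statement

The statement supported by the printed proof carries the extra hypothesis `κ ≤ α` (equivalently:
the fact should let the prover CHOOSE `κ` small, as the paper does); with it the §5 assembly
`CoiculescuPalasek2025_construction_of_parts` goes through unchanged after shrinking the `κ` produced
by `CoiculescuPalasek2025_principalParts` (`IsApproximateSolution.of_exponent_le`). Restating the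
named fact is left to the statement's owners; this file only removes the false one from circulation.
(Status 2026-08-16: the refuted def is now a `@[deprecated]` record in `…Construction`, retired from
the named-fact debt and kept only because this theorem names it — whence the `linter.deprecated`
switch on `not_CoiculescuPalasek2025_perturbation` below; the corrected statement is carried as an
explicit hypothesis in `…CorrectedAssembly` / `…ThresholdAssembly`, and the reduced perturbation
step is PROVED, `CoiculescuPalasek2025_perturbation_reduced` in `…PerturbationReduced`.)

## References

* M. P. Coiculescu, S. Palasek, Invent. Math. 244 (2025), 165–219 = arXiv:2503.14699: §4.2
  Prop. 4.2 and its proof (the weight `t^{(1+κ)/2}` in the `C^{1,κ}` Grönwall step), §4.3 Prop. 4.3,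
  §2.4 (admissible `κ`). [`CoiculescuPalasek2025`]
* T. Kato, Math. Z. 187 (1984) 471–480, Thm. 1 (the weighted class). [`Kato1984`]
* E. Bruè, M. Colombo, G. Crippa, C. De Lellis, M. Sorella, arXiv:2212.08413, §1 Rmk. 2 (pulsed
  Stokes shear flows as degenerate examples; the profile `P_N` is the tree's `PulsedShear.profile`).
  [`BCCDS2024`]
-/

noncomputable section

open MeasureTheory Set Filter UnitAddTorus Function
open scoped ENNReal NNReal InnerProductSpace RealInnerProductSpace Topology ContDiff

namespace Literature.Barriers.NavierStokesRegularity

namespace CoiculescuPalasek2025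

namespace Shear

open Literature.Analysis.FunctionSpaces Literature.Analysis.FunctionSpaces.Torus
open Literature.Analysis.FluidPDE Literature.Analysis.FluidPDE.PulsedShear
open Literature.MathematicalPhysics.QuantumLattice

/-! ## The time profile -/

/-- The smooth step `ρ(x) = smoothTransition (x - 1)`: `ρ = 0` on `x ≤ 1`, `ρ = 1` on `x ≥ 2`,
`0 ≤ ρ ≤ 1`. [folklore] -/
def bump (x : ℝ) : ℝ := Real.smoothTransition (x - 1)

/-- Its derivative `ρ'(x) = smoothTransition' (x - 1)`. [folklore] -/
def bumpDeriv (x : ℝ) : ℝ := deriv Real.smoothTransition (x - 1)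

/-- `ρ` is smooth. [folklore] -/
theorem bump_contDiff : ContDiff ℝ ∞ bump :=
  Real.smoothTransition.contDiff.comp (contDiff_id.sub contDiff_const)

/-- `ρ` has derivative `ρ'` (chain rule). [folklore] -/
theorem hasDerivAt_bump (x : ℝ) : HasDerivAt bump (bumpDeriv x) x := by
  have h1 : HasDerivAt (fun y : ℝ => y - 1) 1 x := (hasDerivAt_id x).sub_const 1
  have h2 : HasDerivAt Real.smoothTransition (deriv Real.smoothTransition (x - 1)) (x - 1) :=
    ((Real.smoothTransition.contDiff (n := 1)).differentiable (by norm_num)).differentiableAt.hasDerivAt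
  have h3 := h2.comp x h1
  have h4 : bump = Real.smoothTransition ∘ fun y : ℝ => y - 1 := rfl
  rw [h4]
  exact h3.congr_deriv (by rw [mul_one]; rfl)

/-- `deriv ρ = ρ'`. [folklore] -/
theorem deriv_bump : deriv bump = bumpDeriv := funext fun x => (hasDerivAt_bump x).deriv

/-- `ρ'` is smooth. [folklore] -/
theorem bumpDeriv_contDiff : ContDiff ℝ ∞ bumpDeriv := by
  rw [← deriv_bump]
  exact bump_contDiff.deriv'

/-- `ρ'` is continuous. [folklore] -/
theorem bumpDeriv_continuous : Continuous bumpDeriv := bumpDeriv_contDiff.continuous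

/-- `0 ≤ ρ`. [folklore] -/
theorem bump_nonneg (x : ℝ) : 0 ≤ bump x := Real.smoothTransition.nonneg _

/-- `ρ ≤ 1`. [folklore] -/
theorem bump_le_one (x : ℝ) : bump x ≤ 1 := Real.smoothTransition.le_one _

/-- `ρ = 0` on `x ≤ 1`. [folklore] -/
theorem bump_of_le_one {x : ℝ} (hx : x ≤ 1) : bump x = 0 :=
  Real.smoothTransition.zero_of_nonpos (by linarith)

/-- `ρ = 1` on `x ≥ 2`. [folklore] -/
theorem bump_of_two_le {x : ℝ} (hx : 2 ≤ x) : bump x = 1 :=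
  Real.smoothTransition.one_of_one_le (by linarith)

/-- `ρ' = 0` on `x < 1` (there `ρ ≡ 0` near `x`). [folklore] -/
theorem bumpDeriv_of_lt_one {x : ℝ} (hx : x < 1) : bumpDeriv x = 0 := by
  rw [← deriv_bump]
  have h : bump =ᶠ[𝓝 x] fun _ => 0 := by
    filter_upwards [Iio_mem_nhds hx] with y hy
    exact bump_of_le_one (le_of_lt hy)
  rw [h.deriv_eq, deriv_const]

/-- `ρ' = 0` on `x > 2` (there `ρ ≡ 1` near `x`). [folklore] -/
theorem bumpDeriv_of_two_lt {x : ℝ} (hx : 2 < x) : bumpDeriv x = 0 := by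
  rw [← deriv_bump]
  have h : bump =ᶠ[𝓝 x] fun _ => 1 := by
    filter_upwards [Ioi_mem_nhds hx] with y hy
    exact bump_of_two_le (le_of_lt hy)
  rw [h.deriv_eq, deriv_const]

/-- **A uniform bound for `ρ'`**: `|ρ'(x)| ≤ R` for all `x`, for some `R ≥ 1` (continuity on the
compact interval `[1, 2]`, outside of which `ρ' = 0`). [folklore] -/
theorem exists_bumpDeriv_le : ∃ R : ℝ, 1 ≤ R ∧ ∀ x, |bumpDeriv x| ≤ R := by
  obtain ⟨R₀, hR₀⟩ := isCompact_Icc.exists_bound_of_continuousOn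
    (bumpDeriv_continuous.continuousOn (s := Icc (1 : ℝ) 2))
  refine ⟨max R₀ 1, le_max_right _ _, fun x => ?_⟩
  rcases lt_or_ge x 1 with hx | hx
  · rw [bumpDeriv_of_lt_one hx, abs_zero]; positivity
  rcases lt_or_ge 2 x with hx2 | hx2
  · rw [bumpDeriv_of_two_lt hx2, abs_zero]; positivity
  · exact ((Real.norm_eq_abs _).symm.trans_le (hR₀ x ⟨hx, hx2⟩)).trans (le_max_left _ _)

/-- The heat decay factor `E(t) = e^{-4π²N²t}` of the mode `N e₁`. [folklore] -/
def decay (N : ℕ) (t : ℝ) : ℝ := Real.exp (-(4 * Real.pi ^ 2 * (N : ℝ) ^ 2) * t)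

/-- `E(t) > 0`. [folklore] -/
theorem decay_pos (N : ℕ) (t : ℝ) : 0 < decay N t := Real.exp_pos _

/-- `E(t) ≤ 1` for `t ≥ 0`. [folklore] -/
theorem decay_le_one (N : ℕ) {t : ℝ} (ht : 0 ≤ t) : decay N t ≤ 1 := by
  rw [decay, Real.exp_le_one_iff, neg_mul, neg_nonpos]
  positivity

/-- `E' = -4π²N² E`. [folklore] -/
theorem hasDerivAt_decay (N : ℕ) (t : ℝ) :
    HasDerivAt (decay N) (-(4 * Real.pi ^ 2 * (N : ℝ) ^ 2) * decay N t) t := by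
  have h : HasDerivAt (fun s : ℝ => -(4 * Real.pi ^ 2 * (N : ℝ) ^ 2) * s)
      (-(4 * Real.pi ^ 2 * (N : ℝ) ^ 2)) t := by
    simpa using (hasDerivAt_id t).const_mul (-(4 * Real.pi ^ 2 * (N : ℝ) ^ 2))
  have h2 : HasDerivAt (fun s : ℝ => Real.exp (-(4 * Real.pi ^ 2 * (N : ℝ) ^ 2) * s))
      (Real.exp (-(4 * Real.pi ^ 2 * (N : ℝ) ^ 2) * t) * (-(4 * Real.pi ^ 2 * (N : ℝ) ^ 2))) t :=
    h.exp
  have h3 : decay N = fun s : ℝ => Real.exp (-(4 * Real.pi ^ 2 * (N : ℝ) ^ 2) * s) := rfl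
  rw [h3]
  exact h2.congr_deriv (mul_comm _ _)

/-- `E` is smooth. [folklore] -/
theorem decay_contDiff (N : ℕ) : ContDiff ℝ ∞ (decay N) :=
  Real.contDiff_exp.comp (contDiff_const.mul contDiff_id)

/-- **The amplitude** `a(t) = -2πN A₀ ρ(t/s₀) e^{-4π²N²t}` of the shear flow. [folklore] -/
def amp (N : ℕ) (A₀ s₀ t : ℝ) : ℝ := -(2 * Real.pi * N * A₀) * bump (t / s₀) * decay N t

/-- Its derivative. [folklore] -/
def ampDeriv (N : ℕ) (A₀ s₀ t : ℝ) : ℝ :=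
  -(2 * Real.pi * N * A₀) * (bumpDeriv (t / s₀) / s₀ * decay N t +
    bump (t / s₀) * (-(4 * Real.pi ^ 2 * (N : ℝ) ^ 2) * decay N t))

/-- **The source amplitude** `g(t) = 2πN A₀ s₀⁻¹ ρ'(t/s₀) e^{-4π²N²t}`, defined by
`a' = -4π²N² a - g`. [folklore] -/
def src (N : ℕ) (A₀ s₀ t : ℝ) : ℝ := 2 * Real.pi * N * A₀ * (bumpDeriv (t / s₀) / s₀) * decay N t

/-- `a` has derivative `a'` (`Shear.ampDeriv`). [folklore] -/
theorem hasDerivAt_amp (N : ℕ) (A₀ s₀ t : ℝ) :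
    HasDerivAt (amp N A₀ s₀) (ampDeriv N A₀ s₀ t) t := by
  have hb : HasDerivAt (fun τ => bump (τ / s₀)) (bumpDeriv (t / s₀) / s₀) t := by
    have h1 : HasDerivAt (fun τ : ℝ => τ / s₀) (1 / s₀) t := by
      simpa using (hasDerivAt_id t).div_const s₀
    have h2 := (hasDerivAt_bump (t / s₀)).comp t h1
    exact h2.congr_deriv (by ring)
  have h : HasDerivAt (fun τ => -(2 * Real.pi * N * A₀) * (bump (τ / s₀) * decay N τ))
      (-(2 * Real.pi * N * A₀) * (bumpDeriv (t / s₀) / s₀ * decay N t +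
        bump (t / s₀) * (-(4 * Real.pi ^ 2 * (N : ℝ) ^ 2) * decay N t))) t :=
    (hb.mul (hasDerivAt_decay N t)).const_mul (-(2 * Real.pi * N * A₀))
  have heq : amp N A₀ s₀ = fun τ => -(2 * Real.pi * N * A₀) * (bump (τ / s₀) * decay N τ) := by
    funext τ
    show -(2 * Real.pi * N * A₀) * bump (τ / s₀) * decay N τ = _
    ring
  rw [heq]
  exact h.congr_deriv rfl

/-- The defining relation of the source: `a'(t) = -4π²N² a(t) - g(t)`. [folklore] -/
theorem ampDeriv_eq (N : ℕ) (A₀ s₀ t : ℝ) :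
    ampDeriv N A₀ s₀ t = -(4 * Real.pi ^ 2 * (N : ℝ) ^ 2) * amp N A₀ s₀ t - src N A₀ s₀ t := by
  simp only [ampDeriv, amp, src]
  ring

/-- `a` is smooth. [folklore] -/
theorem amp_contDiff (N : ℕ) (A₀ s₀ : ℝ) : ContDiff ℝ ∞ (amp N A₀ s₀) := by
  unfold amp
  exact (contDiff_const.mul (bump_contDiff.comp (contDiff_id.div_const s₀))).mul (decay_contDiff N)

/-- `g` is smooth. [folklore] -/
theorem src_contDiff (N : ℕ) (A₀ s₀ : ℝ) : ContDiff ℝ ∞ (src N A₀ s₀) := by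
  unfold src
  exact (contDiff_const.mul ((bumpDeriv_contDiff.comp (contDiff_id.div_const s₀)).div_const s₀)).mul
    (decay_contDiff N)

/-- `|a(t)| ≤ 2πN A₀ e^{-4π²N²t}` for `A₀ ≥ 0` (`0 ≤ ρ ≤ 1`). [folklore] -/
theorem abs_amp_le (N : ℕ) {A₀ : ℝ} (hA : 0 ≤ A₀) (s₀ t : ℝ) :
    |amp N A₀ s₀ t| ≤ 2 * Real.pi * N * A₀ * decay N t := by
  have h1 : |bump (t / s₀)| ≤ 1 := by
    rw [abs_of_nonneg (bump_nonneg _)]; exact bump_le_one _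
  have h2 : 0 ≤ 2 * Real.pi * N * A₀ := by positivity
  rw [amp, abs_mul, abs_mul, abs_neg, abs_of_nonneg h2, abs_of_pos (decay_pos N t)]
  calc 2 * Real.pi * N * A₀ * |bump (t / s₀)| * decay N t
      ≤ 2 * Real.pi * N * A₀ * 1 * decay N t :=
        mul_le_mul_of_nonneg_right (mul_le_mul_of_nonneg_left h1 h2) (decay_pos N t).le
    _ = 2 * Real.pi * N * A₀ * decay N t := by ring

/-- The flow is switched off before `t = s₀`: `a(t) = 0` for `t ≤ s₀` (`s₀ > 0`). [folklore] -/
theorem amp_of_le (N : ℕ) (A₀ : ℝ) {s₀ t : ℝ} (hs : 0 < s₀) (ht : t ≤ s₀) : amp N A₀ s₀ t = 0 := by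
  have : t / s₀ ≤ 1 := (div_le_one hs).2 ht
  simp [amp, bump_of_le_one this]

/-- After `t = 2 s₀` the flow decays freely: `a(t) = -2πN A₀ e^{-4π²N²t}`. [folklore] -/
theorem amp_of_ge (N : ℕ) (A₀ : ℝ) {s₀ t : ℝ} (hs : 0 < s₀) (ht : 2 * s₀ ≤ t) :
    amp N A₀ s₀ t = -(2 * Real.pi * N * A₀) * decay N t := by
  have : 2 ≤ t / s₀ := (le_div_iff₀ hs).2 ht
  simp [amp, bump_of_two_le this]

/-- The source is a pulse on `[s₀, 2s₀]`: `g(t) = 0` for `t < s₀` and for `t > 2s₀`. [folklore] -/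
theorem src_of_lt (N : ℕ) (A₀ : ℝ) {s₀ t : ℝ} (hs : 0 < s₀) (ht : t < s₀) : src N A₀ s₀ t = 0 := by
  have : t / s₀ < 1 := (div_lt_one hs).2 ht
  simp [src, bumpDeriv_of_lt_one this]

/-- `g(t) = 0` for `t > 2s₀`. [folklore] -/
theorem src_of_gt (N : ℕ) (A₀ : ℝ) {s₀ t : ℝ} (hs : 0 < s₀) (ht : 2 * s₀ < t) : src N A₀ s₀ t = 0 := by
  have : 2 < t / s₀ := (lt_div_iff₀ hs).2 ht
  simp [src, bumpDeriv_of_two_lt this]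

/-- `|g(t)| ≤ 2πN A₀ R s₀⁻¹ e^{-4π²N²t}` whenever `|ρ'| ≤ R`. [folklore] -/
theorem abs_src_le (N : ℕ) {A₀ s₀ R : ℝ} (hA : 0 ≤ A₀) (hs : 0 < s₀) (hR : ∀ x, |bumpDeriv x| ≤ R)
    (t : ℝ) : |src N A₀ s₀ t| ≤ 2 * Real.pi * N * A₀ * (R / s₀) * decay N t := by
  have h2 : 0 ≤ 2 * Real.pi * N * A₀ := by positivity
  rw [src, abs_mul, abs_mul, abs_of_nonneg h2, abs_of_pos (decay_pos N t), abs_div, abs_of_pos hs]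
  exact mul_le_mul_of_nonneg_right (mul_le_mul_of_nonneg_left
    (div_le_div_of_nonneg_right (hR _) hs.le) h2) (decay_pos N t).le

/-! ## The spatial objects: the shear mode `P_N` and a symmetric tensor potential `Φ_N` -/

/-- The coefficient matrix `M = [[0,-1,0],[-1,0,-i],[0,-i,0]] / (2πN)` of the tensor potential
(`M_{i1} = -i zᵢ / (2πN)` for the polarisation `z = (-i, 0, 1)` of `P_N`). [folklore] -/
def tmat (N : ℕ) (i j : Fin 3) : ℂ :=
  (![![0, -1, 0], ![-1, 0, -Complex.I], ![0, -Complex.I, 0]] : Fin 3 → Fin 3 → ℂ) i j /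
    (2 * Real.pi * N : ℂ)

/-- `M` is symmetric. [folklore] -/
theorem tmat_symm (N : ℕ) (i j : Fin 3) : tmat N i j = tmat N j i := by
  fin_cases i <;> fin_cases j <;> simp [tmat]

/-- `|M_{ij}| ≤ (2πN)⁻¹`. [folklore] -/
theorem norm_tmat_le (N : ℕ) (hN : 0 < N) (i j : Fin 3) : ‖tmat N i j‖ ≤ 1 / (2 * Real.pi * N) := by
  have hpos : (0 : ℝ) < 2 * Real.pi * N := by positivity
  have hden : ‖(2 * Real.pi * N : ℂ)‖ = 2 * Real.pi * N := by
    rw [show (2 * Real.pi * N : ℂ) = ((2 * Real.pi * N : ℝ) : ℂ) by push_cast; ring]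
    rw [Complex.norm_real, Real.norm_eq_abs, abs_of_pos hpos]
  have hnum : ‖(![![0, -1, 0], ![-1, 0, -Complex.I], ![0, -Complex.I, 0]] : Fin 3 → Fin 3 → ℂ) i j‖ ≤ 1 := by
    fin_cases i <;> fin_cases j <;> simp
  rw [tmat, norm_div, hden]
  exact div_le_div_of_nonneg_right hnum hpos.le

/-- The entries `Φ_{ij}(x) = Re (e_k(x) M_{ij})`, `k = N e₁`, of the tensor potential. [folklore] -/
def tpotEntry (N : ℕ) (i j : Fin 3) : T3 → ℝ :=
  fun x => (trigPoly {freq N} (fun _ => tmat N i j) x).re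

/-- **The tensor potential** `Φ_N : 𝕋³ → ℝ^{3×3}` (symmetric, with `div Φ_N = P_N`). [folklore] -/
def tpot (N : ℕ) : T3 → (Fin 3 → Fin 3 → ℝ) := fun x i j => tpotEntry N i j x

/-- `Φ_{ij}(x) = Re (e_k(x) M_{ij})`. [folklore] -/
theorem tpotEntry_apply (N : ℕ) (i j : Fin 3) (x : T3) :
    tpotEntry N i j x = (mFourier (freq N) x * tmat N i j).re := by
  simp [tpotEntry, trigPoly_apply]

/-- Unfolding `Φ_N`. [folklore] -/
theorem tpot_apply (N : ℕ) (x : T3) (i j : Fin 3) : tpot N x i j = tpotEntry N i j x := rfl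

/-- `Φ_N(x)` is a symmetric matrix. [folklore] -/
theorem tpot_symm (N : ℕ) (x : T3) (i j : Fin 3) : tpot N x i j = tpot N x j i := by
  rw [tpot_apply, tpot_apply, tpotEntry_apply, tpotEntry_apply, tmat_symm]

/-- The entries of `Φ_N` are smooth. [folklore] -/
theorem isSmooth_tpotEntry (N : ℕ) (i j : Fin 3) : IsSmooth (tpotEntry N i j) :=
  isSmooth_re_trigPoly _ _

/-- `Φ_N` is smooth. [folklore] -/
theorem isSmooth_tpot (N : ℕ) : IsSmooth (tpot N) := by
  unfold IsSmooth
  have h : lift (tpot N) = fun y i j => lift (tpotEntry N i j) y := rfl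
  rw [h]
  exact contDiff_pi.2 fun i => contDiff_pi.2 fun j => isSmooth_tpotEntry N i j

/-- `|Φ_{ij}(x)| ≤ (2πN)⁻¹`. [folklore] -/
theorem abs_tpotEntry_le {N : ℕ} (hN : 0 < N) (i j : Fin 3) (x : T3) :
    |tpotEntry N i j x| ≤ 1 / (2 * Real.pi * N) := by
  rw [tpotEntry_apply]
  refine (Complex.abs_re_le_norm _).trans ?_
  rw [norm_mul, norm_mFourier_freq, one_mul]
  exact norm_tmat_le N hN i j

/-- `‖Φ_N(x)‖ ≤ (2πN)⁻¹` (sup norm on `ℝ^{3×3}`). [folklore] -/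
theorem norm_tpot_le {N : ℕ} (hN : 0 < N) (x : T3) : ‖tpot N x‖ ≤ 1 / (2 * Real.pi * N) := by
  have h0 : (0 : ℝ) ≤ 1 / (2 * Real.pi * N) := by positivity
  refine (pi_norm_le_iff_of_nonneg h0).2 fun i => (pi_norm_le_iff_of_nonneg h0).2 fun j => ?_
  rw [Real.norm_eq_abs]
  exact abs_tpotEntry_le hN i j x

/-- Partial derivatives of the entries: `∂ⱼ Φ_{ij'} = Re (2πi kⱼ e_k M_{ij'})`. [folklore] -/
theorem partialDeriv_tpotEntry (N : ℕ) (i j' j : Fin 3) (x : T3) :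
    partialDeriv j (tpotEntry N i j') x =
      (mFourier (freq N) x * ((2 * Real.pi * Complex.I * (freq N j)) * tmat N i j')).re := by
  unfold tpotEntry
  rw [partialDeriv_re_trigPoly]
  simp [trigPoly_apply]

/-- **`div (c Φ_N) = c P_N`**: the tensor potential is a potential for the shear mode. [folklore] -/
theorem matrixDiv_smul_tpot (c : ℝ) {N : ℕ} (hN : 0 < N) (x : T3) :
    matrixDiv (fun y => c • tpot N y) x = c • PulsedShear.profile N x := by
  have hN' : (N : ℂ) ≠ 0 := by exact_mod_cast hN.ne'
  have hπ : (Real.pi : ℂ) ≠ 0 := by exact_mod_cast Real.pi_ne_zero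
  ext i
  rw [matrixDiv_apply, PiLp.smul_apply, smul_eq_mul]
  have hfun : ∀ j, (fun y => (c • tpot N y) i j) = c • tpotEntry N i j := fun j => by
    funext y; simp [tpot_apply]
  simp_rw [hfun]
  have hderiv : ∀ j, partialDeriv j (c • tpotEntry N i j) x = c * partialDeriv j (tpotEntry N i j) x :=
    fun j => by
      rw [partialDeriv_const_smul ((isSmooth_tpotEntry N i j).isContDiff (by simp)) c j]
      rfl
  simp_rw [hderiv, ← Finset.mul_sum]
  congr 1
  rw [Fin.sum_univ_three, partialDeriv_tpotEntry, partialDeriv_tpotEntry, partialDeriv_tpotEntry,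
    PulsedShear.profile, realTrigPoly_apply_coord, trigPoly_apply_coord, Finset.sum_singleton]
  have h0 : (2 * Real.pi * Complex.I * (freq N (0 : Fin 3) : ℂ)) * tmat N i 0 = 0 := by simp
  have h2 : (2 * Real.pi * Complex.I * (freq N (2 : Fin 3) : ℂ)) * tmat N i 2 = 0 := by simp
  have h2πN : (2 * Real.pi * N : ℂ) ≠ 0 := by
    have : (2 : ℂ) ≠ 0 := two_ne_zero
    simp [hπ, hN']
  have h1 : (2 * Real.pi * Complex.I * (freq N (1 : Fin 3) : ℂ)) * tmat N i 1 = pol i := by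
    fin_cases i
    · simp only [freq_apply_one, Int.cast_natCast, tmat, Fin.zero_eta, Fin.isValue,
        Matrix.cons_val_zero, Matrix.cons_val_one, pol_apply_zero]
      field_simp
    · simp [tmat]
    · simp only [freq_apply_one, Int.cast_natCast, tmat, Fin.reduceFinMk, Fin.isValue,
        Matrix.cons_val, pol_apply_two]
      rw [mul_div_assoc', div_eq_one_iff_eq h2πN]
      linear_combination (-(2 : ℂ) * Real.pi * N) * Complex.I_mul_I
  rw [h0, h2, h1]
  simp

/-! ## The shear flow `v = a P_N`, its residual `F = g Φ_N`, and eq. (4.1) in classical form -/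

/-- **The velocity** `v(t) = a(t) P_N`. [folklore] -/
def vel (N : ℕ) (A₀ s₀ : ℝ) (t : ℝ) : T3 → R3 := amp N A₀ s₀ t • PulsedShear.profile N

/-- **The residual tensor** `F(t) = g(t) Φ_N` (symmetric; `div F = g P_N`). [folklore] -/
def res (N : ℕ) (A₀ s₀ : ℝ) (t : ℝ) : T3 → (Fin 3 → Fin 3 → ℝ) := fun x => src N A₀ s₀ t • tpot N x

/-- The pressure `π = 0`. [folklore] -/
def pres0 : ℝ → T3 → ℝ := fun _ _ => 0

/-- Unfolding `v`. [folklore] -/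
@[simp] theorem vel_apply (N : ℕ) (A₀ s₀ t : ℝ) (x : T3) :
    vel N A₀ s₀ t x = amp N A₀ s₀ t • PulsedShear.profile N x := rfl

/-- Unfolding `F`. [folklore] -/
@[simp] theorem res_apply (N : ℕ) (A₀ s₀ t : ℝ) (x : T3) :
    res N A₀ s₀ t x = src N A₀ s₀ t • tpot N x := rfl

/-- `F(t,x)` is a symmetric matrix (Prop. 4.1: `S^{3×3}`). [folklore] -/
theorem res_symm (N : ℕ) (A₀ s₀ t : ℝ) (x : T3) (i j : Fin 3) :
    res N A₀ s₀ t x i j = res N A₀ s₀ t x j i := by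
  simp only [res_apply, Pi.smul_apply, smul_eq_mul, tpot_symm N x i j]

/-- `v` is jointly smooth. [folklore] -/
theorem isSmoothSpaceTimeOn_vel (N : ℕ) (A₀ s₀ : ℝ) (S : Set ℝ) :
    IsSmoothSpaceTimeOn S (vel N A₀ s₀) :=
  (contDiff_stLift_smul_profile (amp_contDiff N A₀ s₀) N).contDiffOn

/-- `F` is jointly smooth. [folklore] -/
theorem isSmoothSpaceTimeOn_res (N : ℕ) (A₀ s₀ : ℝ) (S : Set ℝ) :
    IsSmoothSpaceTimeOn S (res N A₀ s₀) := by
  have h : stLift (res N A₀ s₀) =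
      fun p : ℝ × EuclideanSpace ℝ (Fin 3) => src N A₀ s₀ p.1 • lift (tpot N) p.2 := rfl
  unfold IsSmoothSpaceTimeOn
  rw [h]
  exact (((src_contDiff N A₀ s₀).comp contDiff_fst).smul ((isSmooth_tpot N).comp contDiff_snd)).contDiffOn

/-- `π = 0` is jointly smooth. [folklore] -/
theorem isSmoothSpaceTimeOn_pres0 (S : Set ℝ) : IsSmoothSpaceTimeOn S pres0 := by
  change ContDiffOn ℝ ∞ (fun _ => (0 : ℝ)) _
  exact contDiffOn_const

/-- `∂ₜ v = a' P_N` within `(0, T]`. [folklore] -/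
theorem timeDerivWithin_vel (N : ℕ) (A₀ s₀ : ℝ) {T t : ℝ} (ht : t ∈ Ioc 0 T) (x : T3) :
    timeDerivWithin (Ioc 0 T) (vel N A₀ s₀) t x = ampDeriv N A₀ s₀ t • PulsedShear.profile N x := by
  have h : HasDerivWithinAt (fun τ => vel N A₀ s₀ τ x) (ampDeriv N A₀ s₀ t • PulsedShear.profile N x)
      (Ioc 0 T) t :=
    ((hasDerivAt_amp N A₀ s₀ t).smul_const (PulsedShear.profile N x)).hasDerivWithinAt
  exact h.derivWithin (uniqueDiffOn_Ioc 0 T t ht)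

/-- Shear flows have no self-advection: `((cP_N)·∇)(cP_N) = 0`. [folklore] -/
theorem convect_smul_profile (c : ℝ) (N : ℕ) (x : T3) :
    convect (c • PulsedShear.profile N) (c • PulsedShear.profile N) x = 0 := by
  have h1 : IsContDiff 1 (c • PulsedShear.profile N) := (isContDiff_profile N).smul c
  unfold convect
  rw [fderiv_apply_eq_sum_partialDeriv h1]
  refine Finset.sum_eq_zero fun i _ => ?_
  rw [partialDeriv_const_smul (isContDiff_profile _) c i]
  by_cases hi : i = 1
  · subst hi
    simp [profile_apply_one]
  · rw [Pi.smul_apply c (partialDeriv i (PulsedShear.profile _)), partialDeriv_profile_of_ne_one _ hi,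
      smul_zero, smul_zero]

/-- `Δ v = -4π²N² v`. [folklore] -/
theorem laplacian_vel (N : ℕ) (A₀ s₀ t : ℝ) (x : T3) :
    laplacian (vel N A₀ s₀ t) x =
      (-(4 * Real.pi ^ 2 * (N : ℝ) ^ 2) * amp N A₀ s₀ t) • PulsedShear.profile N x := by
  rw [vel, laplacian_const_smul_profile, laplacian_profile, smul_smul, mul_comm]

/-- `∇π = 0`. [folklore] -/
theorem gradient_pres0 (t : ℝ) (x : T3) : Torus.gradient (pres0 t) x = 0 := by
  unfold pres0 Torus.gradient liftAt
  simp [_root_.gradient]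

/-- `div v = 0`. [folklore] -/
theorem isDivFree_vel (N : ℕ) (A₀ s₀ t : ℝ) : IsDivFree (vel N A₀ s₀ t) := by
  intro x
  have hP := isDivFree_profile N x
  unfold divergence at hP ⊢
  rw [← mul_zero (amp N A₀ s₀ t), ← hP, Finset.mul_sum]
  refine Finset.sum_congr rfl fun i _ => ?_
  have hPi : IsContDiff 1 (fun y => PulsedShear.profile N y i) :=
    (EuclideanSpace.proj i : R3 →L[ℝ] ℝ).contDiff.comp (isContDiff_profile N)
  have h : (fun y => (vel N A₀ s₀ t) y i) = amp N A₀ s₀ t • fun y => PulsedShear.profile N y i := by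
    funext y
    simp
  rw [h, partialDeriv_const_smul hPi, Pi.smul_apply, smul_eq_mul]

/-- **Eq. (4.1) in classical form**: `∂ₜv + (v·∇)v = Δv - ∇π - div F` with `π = 0`, exactly
(`a' = -4π²N² a - g`, `div (g Φ_N) = g P_N`). [folklore] -/
theorem momentum_vel {N : ℕ} (hN : 0 < N) (A₀ s₀ : ℝ) {T t : ℝ} (ht : t ∈ Ioc 0 T) (x : T3) :
    timeDerivWithin (Ioc 0 T) (vel N A₀ s₀) t x + convect (vel N A₀ s₀ t) (vel N A₀ s₀ t) x =
      (1 : ℝ) • laplacian (vel N A₀ s₀ t) x - Torus.gradient (pres0 t) x +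
        (fun t x => -matrixDiv (res N A₀ s₀ t) x) t x := by
  rw [timeDerivWithin_vel N A₀ s₀ ht, laplacian_vel, gradient_pres0, vel, convect_smul_profile,
    add_zero, sub_zero, one_smul]
  show ampDeriv N A₀ s₀ t • PulsedShear.profile N x =
    (-(4 * Real.pi ^ 2 * (N : ℝ) ^ 2) * amp N A₀ s₀ t) • PulsedShear.profile N x +
      -matrixDiv (fun y => src N A₀ s₀ t • tpot N y) x
  rw [matrixDiv_smul_tpot _ hN, ampDeriv_eq, sub_smul, sub_eq_add_neg]

/-- `(v, 0)` is a classical solution of the Navier–Stokes equations (`ν = 1`) forced by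
`-div F` on `(0, T] × 𝕋³`. [folklore] -/
theorem isClassicalNSSolutionOn_vel {N : ℕ} (hN : 0 < N) (A₀ s₀ T : ℝ) :
    IsClassicalNSSolutionOn (Ioc 0 T) 1 (fun t x => -matrixDiv (res N A₀ s₀ t) x)
      (vel N A₀ s₀) pres0 where
  smooth_velocity := isSmoothSpaceTimeOn_vel N A₀ s₀ _
  smooth_pressure := isSmoothSpaceTimeOn_pres0 _
  momentum := fun _ ht x => momentum_vel hN A₀ s₀ ht x
  divFree := fun t _ => isDivFree_vel N A₀ s₀ t

/-- `v(t)` has zero mean (`∫ e_k = 0` for `k = N e₁ ≠ 0`). [folklore] -/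
theorem hasZeroMean_vel {N : ℕ} (hN : 0 < N) (A₀ s₀ t : ℝ) : HasZeroMean (vel N A₀ s₀ t) := by
  unfold HasZeroMean
  have hk : freq N ≠ 0 := by
    intro h
    have := congrFun h 1
    simp [freq] at this
    omega
  have hP : ∫ x, PulsedShear.profile N x = 0 := by
    unfold PulsedShear.profile
    simp_rw [realTrigPoly_singleton_apply]
    have hint : Integrable (fun x : T3 => mFourier (freq N) x • pol) volume :=
      ((mFourier (freq N)).continuous.smul continuous_const).integrable_unitAddTorus
    have h := (EuclideanSpace.realPart (ι := Fin 3)).integral_comp_comm hint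
    rw [h, integral_smul_const, integral_mFourier, if_neg hk, zero_smul, map_zero]
  simp only [vel_apply]
  rw [integral_smul, hP, smul_zero]

/-! ## All-orders derivative bounds for the lifted fields ((3.13a)) -/

/-- The lifted character: `e_k (proj y) = e^{2πi k·y}`. [folklore] -/
theorem mFourier_proj (k : Fin 3 → ℤ) (y : EuclideanSpace ℝ (Fin 3)) : mFourier k (proj y) = eChar k y := by
  have h := mFourier_coe_eq_eChar k (WithLp.ofLp y)
  exact h

/-- `|N e₁|₁ = N`. [folklore] -/
theorem absSum_freq (N : ℕ) : absSum (freq N) = N := by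
  simp [absSum, Fin.sum_univ_three, freq]

/-- `‖z‖ ≤ 2` for the polarisation vector (`‖z‖² = 2`). [folklore] -/
theorem norm_pol_le_two : ‖pol‖ ≤ 2 := by
  nlinarith [norm_pol_sq, norm_nonneg pol]

/-- The real-linear map `z ↦ Re (z • pol)`, `ℂ → ℝ³`, through which `P_N ∘ proj = (Re (· • pol)) ∘ e_k`. [folklore] -/
def polMap : ℂ →L[ℝ] R3 :=
  (EuclideanSpace.realPart (ι := Fin 3)).comp ((ContinuousLinearMap.id ℝ ℂ).smulRight pol)

/-- Unfolding `polMap`. [folklore] -/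
theorem polMap_apply (z : ℂ) : polMap z = EuclideanSpace.realPart (z • pol) := rfl

/-- `‖z ↦ Re (z • pol)‖ ≤ 2`. [folklore] -/
theorem norm_polMap_le : ‖polMap‖ ≤ 2 := by
  refine ContinuousLinearMap.opNorm_le_bound _ (by norm_num) fun z => ?_
  rw [polMap_apply]
  calc ‖EuclideanSpace.realPart (z • pol)‖ ≤ ‖z • pol‖ := EuclideanSpace.norm_realPart_le _
    _ = ‖z‖ * ‖pol‖ := norm_smul _ _
    _ ≤ ‖z‖ * 2 := mul_le_mul_of_nonneg_left norm_pol_le_two (norm_nonneg _)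
    _ = 2 * ‖z‖ := mul_comm _ _

/-- `P_N ∘ proj = (Re (· • pol)) ∘ e_k`. [folklore] -/
theorem lift_profile_eq (N : ℕ) : lift (PulsedShear.profile N) = fun y => polMap (eChar (freq N) y) := by
  funext y
  rw [lift_apply, PulsedShear.profile, realTrigPoly_singleton_apply, polMap_apply, mFourier_proj]

/-- **`‖Dᵐ (P_N ∘ proj)(y)‖ ≤ 2 (2πN)ᵐ`** (chain rule through the character). [folklore] -/
theorem norm_iteratedFDeriv_lift_profile_le (N m : ℕ) (y : EuclideanSpace ℝ (Fin 3)) :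
    ‖iteratedFDeriv ℝ m (lift (PulsedShear.profile N)) y‖ ≤ 2 * (2 * Real.pi * N) ^ m := by
  rw [lift_profile_eq]
  have h1 := polMap.norm_iteratedFDeriv_comp_left (f := eChar (freq N)) (x := y) (n := m)
    ((contDiff_eChar (freq N) (m := ∞)).contDiffAt) (mod_cast le_top)
  refine h1.trans ?_
  have h2 := norm_iteratedFDeriv_eChar_le (freq N) m y
  rw [absSum_freq] at h2
  have h3 : 0 ≤ (2 * Real.pi * N : ℝ) ^ m := by positivity
  calc ‖polMap‖ * ‖iteratedFDeriv ℝ m (eChar (freq N)) y‖ ≤ 2 * (2 * Real.pi * N) ^ m :=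
        mul_le_mul norm_polMap_le h2 (norm_nonneg _) (by norm_num)
    _ = 2 * (2 * Real.pi * N) ^ m := rfl

/-- `‖Dᵐ (v(t) ∘ proj)(y)‖ ≤ |a(t)| · 2 (2πN)ᵐ`. [folklore] -/
theorem norm_iteratedFDeriv_lift_vel_le (N : ℕ) (A₀ s₀ t : ℝ) (m : ℕ) (y : EuclideanSpace ℝ (Fin 3)) :
    ‖iteratedFDeriv ℝ m (lift (vel N A₀ s₀ t)) y‖ ≤ |amp N A₀ s₀ t| * (2 * (2 * Real.pi * N) ^ m) := by
  have h : lift (vel N A₀ s₀ t) = amp N A₀ s₀ t • lift (PulsedShear.profile N) := rfl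
  rw [h, iteratedFDeriv_const_smul_apply (((isSmooth_profile N).of_le (mod_cast le_top)).contDiffAt
    (n := (m : WithTop ℕ∞))), norm_smul, Real.norm_eq_abs]
  exact mul_le_mul_of_nonneg_left (norm_iteratedFDeriv_lift_profile_le N m y) (abs_nonneg _)

/-- **The parabolic weight absorbs all powers of the frequency**:
`(2πN)^{m+1} e^{-4π²N²t} ≤ 3 (m+1)! t^{-(m+1)/2}` for `t > 0` (with `x = 2πN√t`:
`x^{m+1} e^{-x²} ≤ (m+1)! e^{x - x²} ≤ (m+1)! e^{1/4} ≤ 3 (m+1)!`). [folklore] -/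
theorem pow_mul_decay_le (N m : ℕ) {t : ℝ} (ht : 0 < t) :
    (2 * Real.pi * N) ^ (m + 1) * decay N t ≤ 3 * (m + 1).factorial * t ^ (-((m : ℝ) + 1) / 2) := by
  set x : ℝ := 2 * Real.pi * N * Real.sqrt t with hx
  have hx0 : 0 ≤ x := by positivity
  have hsq : Real.sqrt t ^ 2 = t := Real.sq_sqrt ht.le
  -- `(2πN)^{m+1} = x^{m+1} t^{-(m+1)/2}`
  have hpow : (2 * Real.pi * N : ℝ) ^ (m + 1) = x ^ (m + 1) * t ^ (-((m : ℝ) + 1) / 2) := by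
    have h1 : Real.sqrt t ^ (m + 1) * t ^ (-((m : ℝ) + 1) / 2) = 1 := by
      rw [Real.sqrt_eq_rpow, ← Real.rpow_natCast, ← Real.rpow_mul ht.le, ← Real.rpow_add ht]
      have : (1 / 2 * ((m + 1 : ℕ) : ℝ) + -((m : ℝ) + 1) / 2) = 0 := by push_cast; ring
      rw [this, Real.rpow_zero]
    rw [hx, mul_pow (2 * Real.pi * N) (Real.sqrt t) (m + 1),
      mul_assoc ((2 * Real.pi * (N : ℝ)) ^ (m + 1)), h1, mul_one]
  -- `decay = e^{-x²}`
  have hdec : decay N t = Real.exp (-x ^ 2) := by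
    rw [decay, hx]
    congr 1
    rw [mul_pow, hsq]
    ring
  -- `x^{m+1} e^{-x²} ≤ 3 (m+1)!`
  have hfac : (0 : ℝ) < (m + 1).factorial := by exact_mod_cast Nat.factorial_pos _
  have hkey : x ^ (m + 1) * Real.exp (-x ^ 2) ≤ 3 * (m + 1).factorial := by
    have h1 : x ^ (m + 1) ≤ (m + 1).factorial * Real.exp x := by
      have := Real.pow_div_factorial_le_exp x hx0 (m + 1)
      rwa [div_le_iff₀ hfac, mul_comm] at this
    have h2 : Real.exp x * Real.exp (-x ^ 2) ≤ 3 := by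
      rw [← Real.exp_add]
      have h3 : x + -x ^ 2 ≤ 1 := by nlinarith [sq_nonneg (x - 1 / 2)]
      exact (Real.exp_le_exp.2 h3).trans Real.exp_one_lt_three.le
    calc x ^ (m + 1) * Real.exp (-x ^ 2) ≤ (m + 1).factorial * Real.exp x * Real.exp (-x ^ 2) :=
          mul_le_mul_of_nonneg_right h1 (Real.exp_pos _).le
      _ = (m + 1).factorial * (Real.exp x * Real.exp (-x ^ 2)) := by ring
      _ ≤ (m + 1).factorial * 3 := mul_le_mul_of_nonneg_left h2 hfac.le
      _ = 3 * (m + 1).factorial := by ring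
  have htpow : 0 ≤ t ^ (-((m : ℝ) + 1) / 2) := Real.rpow_nonneg ht.le _
  calc (2 * Real.pi * N : ℝ) ^ (m + 1) * decay N t
      = (x ^ (m + 1) * Real.exp (-x ^ 2)) * t ^ (-((m : ℝ) + 1) / 2) := by rw [hpow, hdec]; ring
    _ ≤ 3 * (m + 1).factorial * t ^ (-((m : ℝ) + 1) / 2) := mul_le_mul_of_nonneg_right hkey htpow

/-- **(3.13a) for the shear flow**: `‖∇ᵐ v(t)‖_∞ ≤ 6 (m+1)! t^{-(m+1)/2}` for `0 ≤ A₀ ≤ 1`, `t > 0`. [folklore] -/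
theorem eSupNorm_iteratedFDeriv_lift_vel_le (N : ℕ) {A₀ : ℝ} (hA : 0 ≤ A₀) (hA1 : A₀ ≤ 1) (s₀ : ℝ)
    (m : ℕ) {t : ℝ} (ht : 0 < t) :
    eSupNorm (iteratedFDeriv ℝ m (lift (vel N A₀ s₀ t))) ≤
      ENNReal.ofReal (6 * (m + 1).factorial * t ^ (-((m : ℝ) + 1) / 2)) := by
  refine eSupNorm_le_ofReal fun y => (norm_iteratedFDeriv_lift_vel_le N A₀ s₀ t m y).trans ?_
  have h1 := abs_amp_le N hA s₀ t
  have h2 := pow_mul_decay_le N m ht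
  have htpow : 0 ≤ t ^ (-((m : ℝ) + 1) / 2) := Real.rpow_nonneg ht.le _
  have hpw : 0 ≤ (2 * Real.pi * N : ℝ) ^ m := by positivity
  calc |amp N A₀ s₀ t| * (2 * (2 * Real.pi * N) ^ m)
      ≤ 2 * Real.pi * N * A₀ * decay N t * (2 * (2 * Real.pi * N) ^ m) :=
        mul_le_mul_of_nonneg_right h1 (by positivity)
    _ = 2 * A₀ * ((2 * Real.pi * N) ^ (m + 1) * decay N t) := by ring
    _ ≤ 2 * A₀ * (3 * (m + 1).factorial * t ^ (-((m : ℝ) + 1) / 2)) :=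
        mul_le_mul_of_nonneg_left h2 (by positivity)
    _ ≤ 2 * 1 * (3 * (m + 1).factorial * t ^ (-((m : ℝ) + 1) / 2)) := by gcongr
    _ = 6 * (m + 1).factorial * t ^ (-((m : ℝ) + 1) / 2) := by ring

/-! ## The lacunarity integrals ((3.13b)) -/

/-- `‖v(s)‖_∞ ≤ 4πN A₀ e^{-4π²N²s}` (as a real number). [folklore] -/
theorem toReal_eSupNorm_vel_le (N : ℕ) {A₀ : ℝ} (hA : 0 ≤ A₀) (s₀ s : ℝ) :
    (eSupNorm (vel N A₀ s₀ s)).toReal ≤ 4 * Real.pi * N * A₀ * decay N s := by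
  have h1 : eSupNorm (vel N A₀ s₀ s) ≤ ENNReal.ofReal (|amp N A₀ s₀ s| * 2) := by
    refine eSupNorm_le_ofReal fun x => ?_
    rw [vel_apply, norm_smul, Real.norm_eq_abs]
    exact mul_le_mul_of_nonneg_left ((norm_profile_le N x).trans norm_pol_le_two) (abs_nonneg _)
  have h2 : |amp N A₀ s₀ s| * 2 ≤ 4 * Real.pi * N * A₀ * decay N s := by
    have := abs_amp_le N hA s₀ s
    nlinarith [this]
  have h0 : 0 ≤ 4 * Real.pi * N * A₀ * decay N s := by
    have := decay_pos N s
    positivity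
  exact ENNReal.toReal_le_of_le_ofReal h0 (h1.trans (ENNReal.ofReal_le_ofReal h2))

/-- `∫_{t₁}^{t₂} e^{-cs} ds ≤ c⁻¹` for `c > 0`, `0 ≤ t₁ ≤ t₂`. [folklore] -/
theorem integral_exp_neg_mul_le {c t₁ t₂ : ℝ} (hc : 0 < c) (h0 : 0 ≤ t₁) :
    ∫ s in t₁..t₂, Real.exp (-c * s) ≤ c⁻¹ := by
  have hderiv : ∀ s ∈ uIcc t₁ t₂, HasDerivAt (fun σ => -(Real.exp (-c * σ)) / c) (Real.exp (-c * s)) s := by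
    intro s _
    have h1 : HasDerivAt (fun σ : ℝ => -c * σ) (-c) s := by
      simpa using (hasDerivAt_id s).const_mul (-c)
    have h2 := (h1.exp.neg).div_const c
    refine h2.congr_deriv ?_
    field_simp
  have hint : IntervalIntegrable (fun s => Real.exp (-c * s)) volume t₁ t₂ :=
    (Real.continuous_exp.comp (continuous_const.mul continuous_id)).intervalIntegrable _ _
  rw [intervalIntegral.integral_eq_sub_of_hasDerivAt hderiv hint]
  have h3 : Real.exp (-c * t₁) ≤ 1 := by
    rw [Real.exp_le_one_iff]; nlinarith
  have h4 : 0 < Real.exp (-c * t₂) := Real.exp_pos _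
  rw [div_sub_div_same, div_le_iff₀ hc, inv_mul_cancel₀ hc.ne']
  linarith [h4]

/-- **The Gamma integral** `∫_{t₁}^{t₂} s^{-1/2} e^{-rs} ds ≤ √π · r^{-1/2}` (`r > 0`,
`0 < t₁ ≤ t₂`; Mathlib `Real.integral_rpow_mul_exp_neg_mul_Ioi`, `Γ(1/2) = √π`). [folklore] -/
theorem integral_rpow_neg_half_mul_exp_le {r t₁ t₂ : ℝ} (hr : 0 < r) (h0 : 0 < t₁) (h12 : t₁ ≤ t₂) :
    ∫ s in t₁..t₂, s ^ (-(1 / 2 : ℝ)) * Real.exp (-(r * s)) ≤ Real.sqrt Real.pi * (1 / r) ^ (1 / 2 : ℝ) := by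
  have hG := Real.integral_rpow_mul_exp_neg_mul_Ioi (a := 1 / 2) (r := r) (by norm_num) hr
  have hexp : ((1 : ℝ) / 2 - 1) = -(1 / 2 : ℝ) := by norm_num
  rw [hexp, Real.Gamma_one_half_eq] at hG
  -- the integrand is integrable on `(0, ∞)` (its integral there is positive, hence not junk)
  have hpos : 0 < (1 / r) ^ (1 / 2 : ℝ) * Real.sqrt Real.pi := by positivity
  have hfi : IntegrableOn (fun s : ℝ => s ^ (-(1 / 2 : ℝ)) * Real.exp (-(r * s))) (Ioi 0) := by
    by_contra h
    rw [integral_undef h] at hG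
    linarith
  have hnn : ∀ s ∈ Ioi (0 : ℝ), 0 ≤ s ^ (-(1 / 2 : ℝ)) * Real.exp (-(r * s)) := fun s hs =>
    mul_nonneg (Real.rpow_nonneg (le_of_lt hs) _) (Real.exp_pos _).le
  calc ∫ s in t₁..t₂, s ^ (-(1 / 2 : ℝ)) * Real.exp (-(r * s))
      = ∫ s in Ioc t₁ t₂, s ^ (-(1 / 2 : ℝ)) * Real.exp (-(r * s)) := intervalIntegral.integral_of_le h12
    _ ≤ ∫ s in Ioi 0, s ^ (-(1 / 2 : ℝ)) * Real.exp (-(r * s)) := by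
        refine setIntegral_mono_set hfi ((ae_restrict_iff' measurableSet_Ioi).2 (ae_of_all _ hnn)) ?_
        exact (show Ioc t₁ t₂ ≤ Ioi 0 from fun s hs => h0.trans hs.1).eventuallyLE
    _ = Real.sqrt Real.pi * (1 / r) ^ (1 / 2 : ℝ) := by rw [hG, mul_comm]

/-- **(3.13b) for the shear flow**: for `0 ≤ A₀ ≤ 1`, `0 < N` and `0 < t₁ ≤ t₂`,
`∫_{t₁}^{t₂} (‖v‖²_∞ + s^{-1/2}‖v‖_∞) ds ≤ 6`
(`≤ ∫ (4πNA₀E)² + s^{-1/2} 4πNA₀E ≤ 16π²N²A₀²/(8π²N²) + 4πNA₀ √π/(2πN) = 2A₀² + 2√π A₀`). [folklore] -/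
theorem lacunary_integral_le {N : ℕ} (hN : 0 < N) {A₀ : ℝ} (hA : 0 ≤ A₀) (hA1 : A₀ ≤ 1) (s₀ : ℝ)
    {t₁ t₂ : ℝ} (h0 : 0 < t₁) (h12 : t₁ ≤ t₂) :
    ∫ s in t₁..t₂, ((eSupNorm (vel N A₀ s₀ s)).toReal ^ 2 +
        s ^ (-(1 / 2 : ℝ)) * (eSupNorm (vel N A₀ s₀ s)).toReal) ≤ 6 := by
  set q : ℝ → ℝ := fun s => 4 * Real.pi * N * A₀ * decay N s with hq
  set G : ℝ → ℝ := fun s => q s ^ 2 + s ^ (-(1 / 2 : ℝ)) * q s with hG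
  have hN' : (0 : ℝ) < N := Nat.cast_pos.2 hN
  have hq0 : ∀ s, 0 ≤ q s := fun s => by
    have := decay_pos N s
    simp only [hq]; positivity
  -- pointwise comparison on `[t₁, t₂]`
  have hpt : ∀ s ∈ Icc t₁ t₂, (eSupNorm (vel N A₀ s₀ s)).toReal ^ 2 +
      s ^ (-(1 / 2 : ℝ)) * (eSupNorm (vel N A₀ s₀ s)).toReal ≤ G s := by
    intro s hs
    have h1 := toReal_eSupNorm_vel_le N hA s₀ s
    have h2 : 0 ≤ (eSupNorm (vel N A₀ s₀ s)).toReal := ENNReal.toReal_nonneg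
    have h3 : 0 ≤ s ^ (-(1 / 2 : ℝ)) := Real.rpow_nonneg (h0.le.trans hs.1) _
    simp only [hG]
    exact add_le_add (pow_le_pow_left₀ h2 h1 2) (mul_le_mul_of_nonneg_left h1 h3)
  -- the majorant is continuous on `[t₁, t₂]`, hence integrable
  have hdc : Continuous (decay N) := (decay_contDiff N).continuous
  have hqc : Continuous q := continuous_const.mul hdc
  have hGc : ContinuousOn G (Icc t₁ t₂) := by
    refine (hqc.pow 2).continuousOn.add ((ContinuousOn.rpow_const continuousOn_id fun s hs =>
      Or.inl (h0.trans_le hs.1).ne').mul hqc.continuousOn)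
  have hGi : IntervalIntegrable G volume t₁ t₂ := (hGc.mono (by rw [uIcc_of_le h12])).intervalIntegrable
  -- the two explicit integrals
  have hc : (0 : ℝ) < 8 * Real.pi ^ 2 * N ^ 2 := by positivity
  have hI1 : ∫ s in t₁..t₂, q s ^ 2 ≤ 2 * A₀ ^ 2 := by
    have hq2 : ∀ s, q s ^ 2 = (4 * Real.pi * N * A₀) ^ 2 * Real.exp (-(8 * Real.pi ^ 2 * N ^ 2) * s) :=
      fun s => by
        simp only [hq, decay]
        rw [mul_pow, ← Real.exp_nat_mul]
        congr 1
        push_cast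
        ring
    simp_rw [hq2]
    rw [intervalIntegral.integral_const_mul]
    calc (4 * Real.pi * N * A₀) ^ 2 * ∫ s in t₁..t₂, Real.exp (-(8 * Real.pi ^ 2 * N ^ 2) * s)
        ≤ (4 * Real.pi * N * A₀) ^ 2 * (8 * Real.pi ^ 2 * N ^ 2)⁻¹ :=
          mul_le_mul_of_nonneg_left (integral_exp_neg_mul_le hc h0.le) (sq_nonneg _)
      _ = 2 * A₀ ^ 2 := by
          field_simp
          ring
  have hr : (0 : ℝ) < 4 * Real.pi ^ 2 * N ^ 2 := by positivity
  have hI2 : ∫ s in t₁..t₂, s ^ (-(1 / 2 : ℝ)) * q s ≤ 2 * Real.sqrt Real.pi * A₀ := by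
    have hq1 : ∀ s, s ^ (-(1 / 2 : ℝ)) * q s =
        (4 * Real.pi * N * A₀) * (s ^ (-(1 / 2 : ℝ)) * Real.exp (-((4 * Real.pi ^ 2 * N ^ 2) * s))) :=
      fun s => by
        simp only [hq, decay, neg_mul]
        ring
    simp_rw [hq1]
    rw [intervalIntegral.integral_const_mul]
    have hG2 := integral_rpow_neg_half_mul_exp_le hr h0 h12
    have hroot : (1 / (4 * Real.pi ^ 2 * (N : ℝ) ^ 2)) ^ (1 / 2 : ℝ) = 1 / (2 * Real.pi * N) := by
      rw [show (1 / (4 * Real.pi ^ 2 * (N : ℝ) ^ 2)) = (1 / (2 * Real.pi * N)) ^ 2 by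
        field_simp; ring]
      rw [← Real.sqrt_eq_rpow, Real.sqrt_sq (by positivity)]
    rw [hroot] at hG2
    calc 4 * Real.pi * N * A₀ * ∫ s in t₁..t₂, s ^ (-(1 / 2 : ℝ)) * Real.exp (-(4 * Real.pi ^ 2 * N ^ 2 * s))
        ≤ 4 * Real.pi * N * A₀ * (Real.sqrt Real.pi * (1 / (2 * Real.pi * N))) :=
          mul_le_mul_of_nonneg_left hG2 (by positivity)
      _ = 2 * Real.sqrt Real.pi * A₀ := by
          field_simp
          ring
  have hsqrtpi : Real.sqrt Real.pi ≤ 2 := by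
    rw [Real.sqrt_le_left (by norm_num)]
    linarith [Real.pi_lt_four]
  -- assemble
  by_cases hint : IntervalIntegrable (fun s => (eSupNorm (vel N A₀ s₀ s)).toReal ^ 2 +
      s ^ (-(1 / 2 : ℝ)) * (eSupNorm (vel N A₀ s₀ s)).toReal) volume t₁ t₂
  · calc ∫ s in t₁..t₂, ((eSupNorm (vel N A₀ s₀ s)).toReal ^ 2 +
          s ^ (-(1 / 2 : ℝ)) * (eSupNorm (vel N A₀ s₀ s)).toReal)
        ≤ ∫ s in t₁..t₂, G s := intervalIntegral.integral_mono_on h12 hint hGi hpt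
      _ = (∫ s in t₁..t₂, q s ^ 2) + ∫ s in t₁..t₂, s ^ (-(1 / 2 : ℝ)) * q s := by
          simp only [hG]
          exact intervalIntegral.integral_add ((hqc.pow 2).intervalIntegrable _ _)
            (((ContinuousOn.rpow_const continuousOn_id fun s hs => Or.inl
              (h0.trans_le (by rw [uIcc_of_le h12] at hs; exact hs.1)).ne').mul
              hqc.continuousOn).intervalIntegrable)
      _ ≤ 2 * A₀ ^ 2 + 2 * Real.sqrt Real.pi * A₀ := add_le_add hI1 hI2
      _ ≤ 2 * 1 + 2 * 2 * 1 := by nlinarith [Real.sqrt_nonneg Real.pi]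
      _ = 6 := by norm_num
  · rw [intervalIntegral.integral_undef hint]
    norm_num

/-! ## The residual in the norm of `Y` (Prop. 4.1's bound) -/

/-- The real-linear map `z ↦ (Re (z M_{ij}))_{ij}`, `ℂ → ℝ^{3×3}`, through which
`Φ_N ∘ proj = (·) ∘ e_k`. [folklore] -/
def tpotMap (N : ℕ) : ℂ →L[ℝ] (Fin 3 → Fin 3 → ℝ) :=
  ContinuousLinearMap.pi fun i => ContinuousLinearMap.pi fun j =>
    Complex.reCLM.comp ((ContinuousLinearMap.mul ℝ ℂ).flip (tmat N i j))

/-- Unfolding `tpotMap`. [folklore] -/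
theorem tpotMap_apply (N : ℕ) (z : ℂ) (i j : Fin 3) : tpotMap N z i j = (z * tmat N i j).re := rfl

/-- `‖z ↦ (Re (z M_{ij}))_{ij}‖ ≤ (2πN)⁻¹`. [folklore] -/
theorem norm_tpotMap_le {N : ℕ} (hN : 0 < N) : ‖tpotMap N‖ ≤ 1 / (2 * Real.pi * N) := by
  have h0 : (0 : ℝ) ≤ 1 / (2 * Real.pi * N) := by positivity
  refine ContinuousLinearMap.opNorm_le_bound _ h0 fun z => ?_
  have hz : 0 ≤ 1 / (2 * Real.pi * N) * ‖z‖ := by positivity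
  refine (pi_norm_le_iff_of_nonneg hz).2 fun i => (pi_norm_le_iff_of_nonneg hz).2 fun j => ?_
  rw [tpotMap_apply, Real.norm_eq_abs]
  refine (Complex.abs_re_le_norm _).trans ?_
  rw [norm_mul, mul_comm]
  exact mul_le_mul_of_nonneg_right (norm_tmat_le N hN i j) (norm_nonneg _)

/-- `Φ_N ∘ proj = tpotMap ∘ e_k`. [folklore] -/
theorem lift_tpot_eq (N : ℕ) : lift (tpot N) = fun y => tpotMap N (eChar (freq N) y) := by
  funext y
  funext i j
  rw [lift_apply, tpot_apply, tpotEntry_apply, tpotMap_apply, mFourier_proj]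

/-- **`‖Dᵐ (Φ_N ∘ proj)(y)‖ ≤ (2πN)⁻¹ (2πN)ᵐ`**. [folklore] -/
theorem norm_iteratedFDeriv_lift_tpot_le {N : ℕ} (hN : 0 < N) (m : ℕ) (y : EuclideanSpace ℝ (Fin 3)) :
    ‖iteratedFDeriv ℝ m (lift (tpot N)) y‖ ≤ 1 / (2 * Real.pi * N) * (2 * Real.pi * N) ^ m := by
  rw [lift_tpot_eq]
  have h1 := (tpotMap N).norm_iteratedFDeriv_comp_left (f := eChar (freq N)) (x := y) (n := m)
    ((contDiff_eChar (freq N) (m := ∞)).contDiffAt) (mod_cast le_top)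
  refine h1.trans ?_
  have h2 := norm_iteratedFDeriv_eChar_le (freq N) m y
  rw [absSum_freq] at h2
  exact mul_le_mul (norm_tpotMap_le hN) h2 (norm_nonneg _) (by positivity)

/-- **Hölder seminorm of `D(Φ_N ∘ proj)`**: `[D(Φ_N ∘ proj)]_κ ≤ (2π + 2) N^κ` for `κ ≤ 1`
(interpolation at scale `N⁻¹` between the Lipschitz constant `2πN` — the bound on `D²` — and
the oscillation `≤ 2`). [folklore] -/
theorem eHolderNorm_iteratedFDeriv_one_lift_tpot_le {N : ℕ} (hN : 0 < N) {κ : ℝ≥0} (hκ : κ ≤ 1) :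
    eHolderNorm κ (iteratedFDeriv ℝ 1 (lift (tpot N))) ≤
      ENNReal.ofReal ((2 * Real.pi + 2) * (N : ℝ) ^ (κ : ℝ)) := by
  set f : EuclideanSpace ℝ (Fin 3) → (EuclideanSpace ℝ (Fin 3)) [×1]→L[ℝ] (Fin 3 → Fin 3 → ℝ) :=
    iteratedFDeriv ℝ 1 (lift (tpot N)) with hf
  have hN' : (0 : ℝ) < N := Nat.cast_pos.2 hN
  have hsm : ContDiff ℝ ∞ (lift (tpot N)) := isSmooth_tpot N
  -- the Lipschitz constant `2πN` from the bound on `D²`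
  have hdiff : Differentiable ℝ f :=
    hsm.differentiable_iteratedFDeriv (m := 1) (WithTop.coe_lt_coe.2 (ENat.coe_lt_top 1))
  have hD2 : ∀ y, ‖fderiv ℝ f y‖ ≤ 2 * Real.pi * N := fun y => by
    rw [hf, norm_fderiv_iteratedFDeriv]
    calc ‖iteratedFDeriv ℝ 2 (lift (tpot N)) y‖ ≤ 1 / (2 * Real.pi * N) * (2 * Real.pi * N) ^ 2 :=
          norm_iteratedFDeriv_lift_tpot_le hN 2 y
      _ = 2 * Real.pi * N := by field_simp
  have hL : LipschitzWith (Real.toNNReal (2 * Real.pi * N)) f := by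
    refine LipschitzWith.of_dist_le' fun x y => ?_
    rw [dist_eq_norm, dist_eq_norm]
    exact convex_univ.norm_image_sub_le_of_norm_fderiv_le (fun z _ => hdiff z) (fun z _ => hD2 z)
      (mem_univ y) (mem_univ x)
  -- the oscillation bound `2` from the bound on `D¹`
  have hD1 : ∀ y, ‖f y‖ ≤ 1 := fun y => by
    rw [hf]
    calc ‖iteratedFDeriv ℝ 1 (lift (tpot N)) y‖ ≤ 1 / (2 * Real.pi * N) * (2 * Real.pi * N) ^ 1 :=
          norm_iteratedFDeriv_lift_tpot_le hN 1 y
      _ = 1 := by field_simp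
  have hB : ∀ x y, edist (f x) (f y) ≤ ((2 : ℝ≥0) : ℝ≥0∞) := fun x y =>
    edist_le_coe.2 (dist_le_coe.1 (by
      push_cast
      exact (dist_le_norm_add_norm _ _).trans (by linarith [hD1 x, hD1 y])))
  have hδ : (0 : ℝ≥0) < ((N : ℝ≥0))⁻¹ := by
    rw [inv_pos]; exact_mod_cast hN
  have hH := holderWith_of_lipschitzWith_of_edist_le hL hB hκ hδ
  refine hH.eHolderNorm_le.trans (le_of_eq ?_)
  rw [← ENNReal.ofReal_coe_nnreal]
  congr 1
  push_cast
  rw [Real.coe_toNNReal _ (by positivity)]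
  simp only [inv_inv]
  rw [Real.inv_rpow hN'.le, ← Real.rpow_neg hN'.le, neg_sub]
  have h1 : (N : ℝ) * (N : ℝ) ^ ((κ : ℝ) - 1) = (N : ℝ) ^ (κ : ℝ) := by
    conv_rhs => rw [show (κ : ℝ) = 1 + ((κ : ℝ) - 1) by ring, Real.rpow_add hN', Real.rpow_one]
  linear_combination (2 * Real.pi) * h1

/-- `D(F(t) ∘ proj) = g(t) • D(Φ_N ∘ proj)`. [folklore] -/
theorem iteratedFDeriv_one_lift_res (N : ℕ) (A₀ s₀ t : ℝ) :
    iteratedFDeriv ℝ 1 (lift (res N A₀ s₀ t)) = src N A₀ s₀ t • iteratedFDeriv ℝ 1 (lift (tpot N)) := by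
  have h : lift (res N A₀ s₀ t) = src N A₀ s₀ t • lift (tpot N) := rfl
  funext y
  rw [h, Pi.smul_apply]
  exact iteratedFDeriv_const_smul_apply (((isSmooth_tpot N).of_le (mod_cast le_top)).contDiffAt
    (n := ((1 : ℕ) : WithTop ℕ∞)))

/-- `‖F(t)‖_∞ ≤ |g(t)| (2πN)⁻¹`. [folklore] -/
theorem eSupNorm_res_le {N : ℕ} (hN : 0 < N) (A₀ s₀ t : ℝ) :
    eSupNorm (res N A₀ s₀ t) ≤ ENNReal.ofReal (|src N A₀ s₀ t| * (1 / (2 * Real.pi * N))) := by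
  refine eSupNorm_le_ofReal fun x => ?_
  rw [res_apply, norm_smul, Real.norm_eq_abs]
  exact mul_le_mul_of_nonneg_left (norm_tpot_le hN x) (abs_nonneg _)

/-- Elementary: `(2s)^{e} ≤ 2^{3/2} s^{e}` for `0 ≤ e ≤ 3/2`, `s ≥ 0`. [folklore] -/
theorem two_mul_rpow_le {s e : ℝ} (hs : 0 ≤ s) (he : e ≤ 3 / 2) :
    (2 * s) ^ e ≤ 3 * s ^ e := by
  rw [Real.mul_rpow (by norm_num) hs]
  refine mul_le_mul_of_nonneg_right ?_ (Real.rpow_nonneg hs _)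
  calc (2 : ℝ) ^ e ≤ 2 ^ (3 / 2 : ℝ) := Real.rpow_le_rpow_of_exponent_le (by norm_num) he
    _ ≤ 3 := by
        have h : (2 : ℝ) ^ (3 / 2 : ℝ) = Real.sqrt 8 := by
          rw [show (8 : ℝ) = 2 ^ (3 : ℝ) by norm_num, Real.sqrt_eq_rpow, ← Real.rpow_mul (by norm_num)]
          norm_num
        rw [h, Real.sqrt_le_left (by norm_num)]
        norm_num

/-- **The residual in the norm of `Y`.** For `0 ≤ α ≤ 1`, `κ ≤ 1`, `A₀ ≥ 0`, `s₀ > 0`, `N ≥ 1`,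
`|ρ'| ≤ R`, and every `t > 0`:
`t^{1-α}‖F(t)‖_∞ + t^{3/2-α}[DF(t)∘proj]_κ ≤ A₀ R s₀^{-α} (2 + 200 s₀^{1/2} N^{1+κ})`
(`F(t) = 0` unless `t ∈ [s₀, 2s₀]`, where `|g(t)| ≤ 2πN A₀ R/s₀`, `‖Φ_N‖ ≤ (2πN)⁻¹`,
`[DΦ_N∘proj]_κ ≤ (2π+2)N^κ`). [folklore] -/
theorem residual_le {N : ℕ} (hN : 0 < N) {A₀ s₀ R : ℝ} (hA : 0 ≤ A₀) (hs : 0 < s₀)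
    (hR : ∀ x, |bumpDeriv x| ≤ R) {α : ℝ} (hα0 : 0 ≤ α) (hα1 : α ≤ 1) {κ : ℝ≥0} (hκ : κ ≤ 1)
    {t : ℝ} (ht : 0 < t) :
    ENNReal.ofReal (t ^ (1 - α)) * eSupNorm (res N A₀ s₀ t) +
        ENNReal.ofReal (t ^ (3 / 2 - α)) *
          eHolderNorm κ (iteratedFDeriv ℝ 1 (lift (res N A₀ s₀ t))) ≤
      ENNReal.ofReal (A₀ * R * s₀ ^ (-α) *
        (2 + 200 * (s₀ ^ (1 / 2 : ℝ) * (N : ℝ) ^ (1 + (κ : ℝ))))) := by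
  have hN' : (0 : ℝ) < N := Nat.cast_pos.2 hN
  have hR0 : 0 ≤ R := (abs_nonneg _).trans (hR 0)
  by_cases hts : s₀ ≤ t ∧ t ≤ 2 * s₀
  swap
  · -- outside the pulse the residual vanishes
    have hsrc : src N A₀ s₀ t = 0 := by
      rcases not_and_or.1 hts with h1 | h2
      · exact src_of_lt N A₀ hs (not_le.1 h1)
      · exact src_of_gt N A₀ hs (not_le.1 h2)
    have h1 : eSupNorm (res N A₀ s₀ t) ≤ 0 := by
      refine (eSupNorm_le_ofReal (M := 0) fun x => ?_).trans (by simp)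
      rw [res_apply, hsrc, zero_smul, norm_zero]
    have h2 : eHolderNorm κ (iteratedFDeriv ℝ 1 (lift (res N A₀ s₀ t))) = 0 := by
      rw [iteratedFDeriv_one_lift_res, hsrc, zero_smul, eHolderNorm_zero]
    rw [h2, mul_zero, add_zero]
    calc ENNReal.ofReal (t ^ (1 - α)) * eSupNorm (res N A₀ s₀ t)
        ≤ ENNReal.ofReal (t ^ (1 - α)) * 0 := mul_le_mul' le_rfl h1
      _ = 0 := mul_zero _
      _ ≤ _ := bot_le
  obtain ⟨ht1, ht2⟩ := hts
  -- sizes during the pulse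
  have hsrc : |src N A₀ s₀ t| ≤ 2 * Real.pi * N * A₀ * (R / s₀) := by
    have h := abs_src_le N hA hs hR t
    have hd : decay N t ≤ 1 := decay_le_one N ht.le
    have h0 : 0 ≤ 2 * Real.pi * N * A₀ * (R / s₀) := by positivity
    calc |src N A₀ s₀ t| ≤ 2 * Real.pi * N * A₀ * (R / s₀) * decay N t := h
      _ ≤ 2 * Real.pi * N * A₀ * (R / s₀) * 1 := mul_le_mul_of_nonneg_left hd h0
      _ = _ := mul_one _
  have hE1 := eSupNorm_res_le hN A₀ s₀ t
  have hE2 : eHolderNorm κ (iteratedFDeriv ℝ 1 (lift (res N A₀ s₀ t))) ≤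
      ENNReal.ofReal (|src N A₀ s₀ t| * ((2 * Real.pi + 2) * (N : ℝ) ^ (κ : ℝ))) := by
    rw [iteratedFDeriv_one_lift_res, eHolderNorm_smul, ENNReal.ofReal_mul (abs_nonneg _),
      ← ENNReal.ofReal_coe_nnreal, coe_nnnorm, Real.norm_eq_abs]
    exact mul_le_mul' le_rfl (eHolderNorm_iteratedFDeriv_one_lift_tpot_le hN hκ)
  -- reduce to a real inequality
  have hpos1 : 0 ≤ t ^ (1 - α) := Real.rpow_nonneg ht.le _
  have hpos2 : 0 ≤ t ^ (3 / 2 - α) := Real.rpow_nonneg ht.le _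
  have hq1 : 0 ≤ |src N A₀ s₀ t| * (1 / (2 * Real.pi * N)) := by positivity
  have hq2 : 0 ≤ |src N A₀ s₀ t| * ((2 * Real.pi + 2) * (N : ℝ) ^ (κ : ℝ)) := by positivity
  calc ENNReal.ofReal (t ^ (1 - α)) * eSupNorm (res N A₀ s₀ t) +
        ENNReal.ofReal (t ^ (3 / 2 - α)) * eHolderNorm κ (iteratedFDeriv ℝ 1 (lift (res N A₀ s₀ t)))
      ≤ ENNReal.ofReal (t ^ (1 - α)) * ENNReal.ofReal (|src N A₀ s₀ t| * (1 / (2 * Real.pi * N))) +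
        ENNReal.ofReal (t ^ (3 / 2 - α)) *
          ENNReal.ofReal (|src N A₀ s₀ t| * ((2 * Real.pi + 2) * (N : ℝ) ^ (κ : ℝ))) :=
        add_le_add (mul_le_mul' le_rfl hE1) (mul_le_mul' le_rfl hE2)
    _ = ENNReal.ofReal (t ^ (1 - α) * (|src N A₀ s₀ t| * (1 / (2 * Real.pi * N))) +
          t ^ (3 / 2 - α) * (|src N A₀ s₀ t| * ((2 * Real.pi + 2) * (N : ℝ) ^ (κ : ℝ)))) := by
        rw [← ENNReal.ofReal_mul hpos1, ← ENNReal.ofReal_mul hpos2,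
          ← ENNReal.ofReal_add (mul_nonneg hpos1 hq1) (mul_nonneg hpos2 hq2)]
    _ ≤ _ := ENNReal.ofReal_le_ofReal ?_
  -- the real inequality
  have hS : |src N A₀ s₀ t| ≤ 2 * Real.pi * N * A₀ * (R / s₀) := hsrc
  -- first term
  have hT1 : t ^ (1 - α) * (|src N A₀ s₀ t| * (1 / (2 * Real.pi * N))) ≤ 2 * (A₀ * R * s₀ ^ (-α)) := by
    have h1 : t ^ (1 - α) ≤ 3 * s₀ ^ (1 - α) :=
      (Real.rpow_le_rpow ht.le ht2 (by linarith)).trans (two_mul_rpow_le hs.le (by linarith))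
    have h1' : t ^ (1 - α) ≤ 2 * s₀ ^ (1 - α) := by
      refine (Real.rpow_le_rpow ht.le ht2 (by linarith)).trans ?_
      rw [Real.mul_rpow (by norm_num) hs.le]
      refine mul_le_mul_of_nonneg_right ?_ (Real.rpow_nonneg hs.le _)
      calc (2 : ℝ) ^ (1 - α) ≤ 2 ^ (1 : ℝ) := Real.rpow_le_rpow_of_exponent_le (by norm_num) (by linarith)
        _ = 2 := Real.rpow_one _
    have h2 : |src N A₀ s₀ t| * (1 / (2 * Real.pi * N)) ≤ A₀ * (R / s₀) := by
      calc |src N A₀ s₀ t| * (1 / (2 * Real.pi * N)) ≤ 2 * Real.pi * N * A₀ * (R / s₀) * (1 / (2 * Real.pi * N)) :=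
            mul_le_mul_of_nonneg_right hS (by positivity)
        _ = A₀ * (R / s₀) := by field_simp
    have h3 : s₀ ^ (1 - α) * (R / s₀) = R * s₀ ^ (-α) := by
      have e1 : s₀ ^ (1 - α) = s₀ * s₀ ^ (-α) := by
        rw [show (1 - α) = 1 + (-α) by ring, Real.rpow_add hs, Real.rpow_one]
      rw [e1]
      field_simp
    calc t ^ (1 - α) * (|src N A₀ s₀ t| * (1 / (2 * Real.pi * N)))
        ≤ (2 * s₀ ^ (1 - α)) * (A₀ * (R / s₀)) :=
          mul_le_mul h1' h2 hq1 (by positivity)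
      _ = 2 * A₀ * (s₀ ^ (1 - α) * (R / s₀)) := by ring
      _ = 2 * (A₀ * R * s₀ ^ (-α)) := by rw [h3]; ring
  -- second term
  have hT2 : t ^ (3 / 2 - α) * (|src N A₀ s₀ t| * ((2 * Real.pi + 2) * (N : ℝ) ^ (κ : ℝ))) ≤
      200 * (A₀ * R * s₀ ^ (-α)) * (s₀ ^ (1 / 2 : ℝ) * (N : ℝ) ^ (1 + (κ : ℝ))) := by
    have h1 : t ^ (3 / 2 - α) ≤ 3 * s₀ ^ (3 / 2 - α) :=
      (Real.rpow_le_rpow ht.le ht2 (by linarith)).trans (two_mul_rpow_le hs.le (by linarith))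
    have h2 : |src N A₀ s₀ t| * ((2 * Real.pi + 2) * (N : ℝ) ^ (κ : ℝ)) ≤
        2 * Real.pi * N * A₀ * (R / s₀) * ((2 * Real.pi + 2) * (N : ℝ) ^ (κ : ℝ)) :=
      mul_le_mul_of_nonneg_right hS (by positivity)
    have h3 : s₀ ^ (3 / 2 - α) * (R / s₀) = R * s₀ ^ (-α) * s₀ ^ (1 / 2 : ℝ) := by
      have e1 : s₀ ^ (3 / 2 - α) = s₀ * s₀ ^ (-α) * s₀ ^ (1 / 2 : ℝ) := by
        rw [show (3 / 2 - α) = 1 + (-α) + 1 / 2 by ring, Real.rpow_add hs, Real.rpow_add hs,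
          Real.rpow_one]
      rw [e1]
      field_simp
    have h4 : (N : ℝ) * (N : ℝ) ^ (κ : ℝ) = (N : ℝ) ^ (1 + (κ : ℝ)) := by
      rw [Real.rpow_add hN', Real.rpow_one]
    have hπ : 2 * Real.pi * (2 * Real.pi + 2) * 3 ≤ 200 := by
      nlinarith [Real.pi_lt_d2, Real.pi_pos]
    have hX : 0 ≤ A₀ * R * s₀ ^ (-α) * (s₀ ^ (1 / 2 : ℝ) * (N : ℝ) ^ (1 + (κ : ℝ))) := by positivity
    calc t ^ (3 / 2 - α) * (|src N A₀ s₀ t| * ((2 * Real.pi + 2) * (N : ℝ) ^ (κ : ℝ)))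
        ≤ (3 * s₀ ^ (3 / 2 - α)) * (2 * Real.pi * N * A₀ * (R / s₀) * ((2 * Real.pi + 2) * (N : ℝ) ^ (κ : ℝ))) :=
          mul_le_mul h1 h2 hq2 (by positivity)
      _ = (2 * Real.pi * (2 * Real.pi + 2) * 3) * (A₀ * (s₀ ^ (3 / 2 - α) * (R / s₀)) *
            ((N : ℝ) * (N : ℝ) ^ (κ : ℝ))) := by ring
      _ = (2 * Real.pi * (2 * Real.pi + 2) * 3) *
            (A₀ * R * s₀ ^ (-α) * (s₀ ^ (1 / 2 : ℝ) * (N : ℝ) ^ (1 + (κ : ℝ)))) := by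
          rw [h3, h4]; ring
      _ ≤ 200 * (A₀ * R * s₀ ^ (-α) * (s₀ ^ (1 / 2 : ℝ) * (N : ℝ) ^ (1 + (κ : ℝ)))) :=
          mul_le_mul_of_nonneg_right hπ hX
      _ = _ := by ring
  calc t ^ (1 - α) * (|src N A₀ s₀ t| * (1 / (2 * Real.pi * N))) +
        t ^ (3 / 2 - α) * (|src N A₀ s₀ t| * ((2 * Real.pi + 2) * (N : ℝ) ^ (κ : ℝ)))
      ≤ 2 * (A₀ * R * s₀ ^ (-α)) + 200 * (A₀ * R * s₀ ^ (-α)) * (s₀ ^ (1 / 2 : ℝ) * (N : ℝ) ^ (1 + (κ : ℝ))) :=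
        add_le_add hT1 hT2
    _ = A₀ * R * s₀ ^ (-α) * (2 + 200 * (s₀ ^ (1 / 2 : ℝ) * (N : ℝ) ^ (1 + (κ : ℝ)))) := by ring

/-! ## Assembly: the shear flow is an approximate solution in the sense of Coiculescu–Palasek -/

/-- **The forced shear flow is an approximate solution** in the sense of
`CoiculescuPalasek2025.IsApproximateSolution` on `(0, T_*]`, with the UNIVERSAL constants
`K m = 6 (m+1)!`, `C = 6`, any slope `η ≥ 0`, any `α ∈ [0, 1]`, `κ ≤ 1`, and residual size
`ε₀ ≥ A₀ R s₀^{-α} (2 + 200 s₀^{1/2} N^{1+κ})` (`0 < A₀ ≤ 1`, `s₀ > 0`, `N ≥ 1`, `|ρ'| ≤ R`). [folklore] -/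
theorem isApproximateSolution {N : ℕ} (hN : 0 < N) {A₀ s₀ R : ℝ} (hA : 0 < A₀) (hA1 : A₀ ≤ 1)
    (hs : 0 < s₀) (hR : ∀ x, |bumpDeriv x| ≤ R) {α : ℝ} (hα0 : 0 ≤ α) (hα1 : α ≤ 1) {κ : ℝ≥0}
    (hκ : κ ≤ 1) {η : ℝ} (hη : 0 ≤ η) {ε₀ : ℝ}
    (hε : A₀ * R * s₀ ^ (-α) * (2 + 200 * (s₀ ^ (1 / 2 : ℝ) * (N : ℝ) ^ (1 + (κ : ℝ)))) ≤ ε₀) :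
    IsApproximateSolution unitTime α κ (fun m => 6 * ((m + 1).factorial : ℝ)) 6 η ε₀
      (vel N A₀ s₀) (res N A₀ s₀) pres0 where
  solution := isClassicalNSSolutionOn_vel hN A₀ s₀ unitTime
  smooth_residual := isSmoothSpaceTimeOn_res N A₀ s₀ _
  residual_symm := fun t _ x i j => res_symm N A₀ s₀ t x i j
  hasZeroMean := fun t _ => hasZeroMean_vel hN A₀ s₀ t
  deriv_le := fun m t ht => eSupNorm_iteratedFDeriv_lift_vel_le N hA.le hA1 s₀ m ht.1
  lacunary_le := fun t₁ t₂ h1 h12 _ => by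
    refine (lacunary_integral_le hN hA.le hA1 s₀ h1 h12).trans ?_
    have hlog : 0 ≤ Real.log (t₂ / t₁) := Real.log_nonneg ((one_le_div h1).2 h12)
    nlinarith [mul_nonneg hη hlog]
  residual_le := fun t ht =>
    (residual_le hN hA.le hs hR hα0 hα1 hκ ht.1).trans (ENNReal.ofReal_le_ofReal hε)

/-! ## What the refutation needs about `v` beyond the structure -/

/-- Before the pulse the flow is at rest: `v(t) = 0` for `t ≤ s₀`. [folklore] -/
theorem vel_of_le (N : ℕ) (A₀ : ℝ) {s₀ t : ℝ} (hs : 0 < s₀) (ht : t ≤ s₀) : vel N A₀ s₀ t = 0 := by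
  funext x
  rw [vel_apply, amp_of_le N A₀ hs ht, zero_smul]
  rfl

/-- `x^{2β} e^{-x²} ≤ 1` for `x ≥ 0`, `0 ≤ 2β ≤ 2`. [folklore] -/
theorem rpow_mul_exp_neg_sq_le_one {x b : ℝ} (hx : 0 ≤ x) (hb0 : 0 ≤ b) (hb : b ≤ 2) :
    x ^ b * Real.exp (-x ^ 2) ≤ 1 := by
  rcases le_or_gt x 1 with h | h
  · calc x ^ b * Real.exp (-x ^ 2) ≤ 1 * 1 := by
          refine mul_le_mul (Real.rpow_le_one hx h hb0) ?_ (Real.exp_pos _).le zero_le_one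
          rw [Real.exp_le_one_iff]; nlinarith
      _ = 1 := one_mul _
  · have h1 : x ^ b ≤ x ^ (2 : ℝ) := Real.rpow_le_rpow_of_exponent_le h.le hb
    rw [Real.rpow_two] at h1
    have h3 : x ^ 2 ≤ Real.exp (x ^ 2) := by nlinarith [Real.add_one_le_exp (x ^ 2)]
    rw [Real.exp_neg]
    have h4 : 0 < Real.exp (x ^ 2) := Real.exp_pos _
    rw [mul_inv_le_iff₀ h4, one_mul]
    exact h1.trans h3

/-- **The shear flow lies in every Kato weighted class**: for `0 ≤ β ≤ 1`, `t > 0`,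
`‖v(t, x)‖ ≤ 2 A₀ (2πN)^{1-2β} t^{-β}` (`‖v‖ ≤ 4πN A₀ e^{-4π²N²t}` and
`(2πN√t)^{2β} e^{-(2πN√t)²} ≤ 1`). [folklore] -/
theorem norm_vel_le (N : ℕ) {A₀ : ℝ} (hA : 0 ≤ A₀) (s₀ : ℝ) {β : ℝ} (hβ0 : 0 ≤ β) (hβ1 : β ≤ 1)
    {t : ℝ} (ht : 0 < t) (x : T3) :
    ‖vel N A₀ s₀ t x‖ ≤ 2 * A₀ * (2 * Real.pi * N) ^ (1 - 2 * β) * t ^ (-β) := by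
  have h1 : ‖vel N A₀ s₀ t x‖ ≤ 4 * Real.pi * N * A₀ * decay N t := by
    rw [vel_apply, norm_smul, Real.norm_eq_abs]
    have := abs_amp_le N hA s₀ t
    have hP := (norm_profile_le N x).trans norm_pol_le_two
    calc |amp N A₀ s₀ t| * ‖PulsedShear.profile N x‖ ≤ (2 * Real.pi * N * A₀ * decay N t) * 2 :=
          mul_le_mul this hP (norm_nonneg _) (by have := decay_pos N t; positivity)
      _ = 4 * Real.pi * N * A₀ * decay N t := by ring
  refine h1.trans ?_
  rcases Nat.eq_zero_or_pos N with hN0 | hN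
  · subst hN0
    simp only [Nat.cast_zero, mul_zero, zero_mul]
    positivity
  have hc : (0 : ℝ) < 2 * Real.pi * N := by positivity
  set y : ℝ := 2 * Real.pi * N * Real.sqrt t with hy
  have hy0 : 0 ≤ y := by positivity
  have hkey := rpow_mul_exp_neg_sq_le_one hy0 (by linarith : 0 ≤ 2 * β) (by linarith : 2 * β ≤ 2)
  -- `y^{2β} = (2πN)^{2β} t^{β}`, `e^{-y²} = decay`
  have hy2 : y ^ (2 * β) = (2 * Real.pi * N) ^ (2 * β) * t ^ β := by
    rw [hy, Real.mul_rpow hc.le (Real.sqrt_nonneg _), Real.sqrt_eq_rpow, ← Real.rpow_mul ht.le]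
    congr 2
    ring
  have hdec : Real.exp (-y ^ 2) = decay N t := by
    rw [decay, hy]
    congr 1
    rw [mul_pow, Real.sq_sqrt ht.le]
    ring
  rw [hy2, hdec] at hkey
  -- rearrange
  have htβ : t ^ (-β) * t ^ β = 1 := by
    rw [← Real.rpow_add ht]; norm_num
  have hcc : (2 * Real.pi * N : ℝ) ^ (1 - 2 * β) * (2 * Real.pi * N) ^ (2 * β) = 2 * Real.pi * N := by
    rw [← Real.rpow_add hc]; norm_num
  have hpos : 0 ≤ 2 * A₀ * (2 * Real.pi * N) ^ (1 - 2 * β) * t ^ (-β) := by positivity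
  have hL : 2 * A₀ * (2 * Real.pi * N) ^ (1 - 2 * β) * t ^ (-β) *
      ((2 * Real.pi * N) ^ (2 * β) * t ^ β * decay N t) = 4 * Real.pi * N * A₀ * decay N t := by
    calc 2 * A₀ * (2 * Real.pi * N) ^ (1 - 2 * β) * t ^ (-β) *
          ((2 * Real.pi * N) ^ (2 * β) * t ^ β * decay N t)
        = 2 * A₀ * ((2 * Real.pi * N) ^ (1 - 2 * β) * (2 * Real.pi * N) ^ (2 * β)) *
            (t ^ (-β) * t ^ β) * decay N t := by ring
      _ = 4 * Real.pi * N * A₀ * decay N t := by rw [hcc, htβ]; ring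
  calc 4 * Real.pi * N * A₀ * decay N t
      = 2 * A₀ * (2 * Real.pi * N) ^ (1 - 2 * β) * t ^ (-β) *
          ((2 * Real.pi * N) ^ (2 * β) * t ^ β * decay N t) := hL.symm
    _ ≤ 2 * A₀ * (2 * Real.pi * N) ^ (1 - 2 * β) * t ^ (-β) * 1 :=
        mul_le_mul_of_nonneg_left hkey hpos
    _ = _ := mul_one _

/-- The character at the origin: `e_k(0) = 1`. [folklore] -/
theorem eChar_zero_right (k : Fin 3 → ℤ) : eChar k (0 : EuclideanSpace ℝ (Fin 3)) = 1 := by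
  simp [eChar, intForm_apply]

/-- The character `e_{N e₁}` at the point `(2N)⁻¹ e₁` equals `e^{iπ} = -1`. [folklore] -/
theorem eChar_freq_half {N : ℕ} (hN : 0 < N) :
    eChar (freq N) (EuclideanSpace.single 1 (1 / (2 * N) : ℝ)) = -1 := by
  have hN' : (N : ℝ) ≠ 0 := by exact_mod_cast hN.ne'
  have hform : intForm (freq N) (EuclideanSpace.single 1 (1 / (2 * N) : ℝ)) = 1 / 2 := by
    rw [intForm_apply, Fin.sum_univ_three]
    simp [freq]
    field_simp
  rw [eChar, hform, Real.fourierChar_apply]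
  have : ((2 * Real.pi * (1 / 2) : ℝ) : ℂ) * Complex.I = Real.pi * Complex.I := by
    push_cast; ring
  rw [this, Complex.exp_pi_mul_I]

/-- The first derivative of the lifted profile along `e₁`:
`D(P_N ∘ proj)(y) e₁ = Re (e_k(y) · 2πiN z)`. [folklore] -/
theorem fderiv_lift_profile_single (N : ℕ) (y : EuclideanSpace ℝ (Fin 3)) :
    fderiv ℝ (lift (PulsedShear.profile N)) y (EuclideanSpace.single 1 1) =
      EuclideanSpace.realPart (eChar (freq N) y • ((2 * Real.pi * Complex.I * N) • pol)) := by
  rw [fderiv_lift, ← partialDeriv_eq_fderiv_apply (isContDiff_profile N), partialDeriv_profile,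
    mFourier_proj, freq_apply_one, Int.cast_natCast]

/-- `‖Re (2πiN z)‖ = 2πN` for `z = (-i, 0, 1)` (the vector `(2πN, 0, 0)`). [folklore] -/
theorem norm_realPart_deriv_pol (N : ℕ) :
    ‖EuclideanSpace.realPart ((2 * Real.pi * Complex.I * N) • pol)‖ = 2 * Real.pi * N := by
  have h : EuclideanSpace.realPart ((2 * Real.pi * Complex.I * N) • pol) =
      EuclideanSpace.single 0 (2 * Real.pi * N : ℝ) := by
    ext i
    fin_cases i <;> simp [EuclideanSpace.realPart_apply]
  rw [h, show ‖EuclideanSpace.single (0 : Fin 3) (2 * Real.pi * N : ℝ)‖ = ‖(2 * Real.pi * N : ℝ)‖ by simp,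
    Real.norm_eq_abs, abs_of_nonneg (by positivity)]

/-- **Lower bound for the Hölder seminorm of `D(P_N ∘ proj)`**: `[D(P_N∘proj)]_κ ≥ 4πN (2N)^κ`
(compare the derivative along `e₁` at `0` and at `(2N)⁻¹e₁`, where the character is `±1`). [folklore] -/
theorem le_eHolderNorm_iteratedFDeriv_one_lift_profile {N : ℕ} (hN : 0 < N) (κ : ℝ≥0) :
    ENNReal.ofReal (4 * Real.pi * N * (2 * N : ℝ) ^ (κ : ℝ)) ≤
      eHolderNorm κ (iteratedFDeriv ℝ 1 (lift (PulsedShear.profile N))) := by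
  set g := iteratedFDeriv ℝ 1 (lift (PulsedShear.profile N)) with hg
  set y1 : EuclideanSpace ℝ (Fin 3) := EuclideanSpace.single 1 (1 / (2 * N) : ℝ) with hy1
  have hN' : (0 : ℝ) < N := Nat.cast_pos.2 hN
  have h2N : (0 : ℝ) < 1 / (2 * N) := by positivity
  -- the derivative gap between the two points
  have hgap : 4 * Real.pi * N ≤ ‖g 0 - g y1‖ := by
    set m : Fin 1 → EuclideanSpace ℝ (Fin 3) := fun _ => EuclideanSpace.single 1 1 with hm
    have h1 : ‖(g 0 - g y1) m‖ ≤ ‖g 0 - g y1‖ * ∏ i, ‖m i‖ := ContinuousMultilinearMap.le_opNorm _ _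
    have hprod : ∏ i, ‖m i‖ = 1 := by
      simp [hm]
    rw [hprod, mul_one] at h1
    refine le_trans (le_of_eq ?_) h1
    rw [sub_apply, hg, iteratedFDeriv_one_apply, iteratedFDeriv_one_apply, hm]
    dsimp only
    rw [fderiv_lift_profile_single, fderiv_lift_profile_single, eChar_zero_right, hy1,
      eChar_freq_half hN, one_smul, neg_one_smul, map_neg, sub_neg_eq_add, ← two_smul ℝ,
      norm_smul, norm_realPart_deriv_pol, Real.norm_two]
    ring
  have hdist : edist (0 : EuclideanSpace ℝ (Fin 3)) y1 = ENNReal.ofReal (1 / (2 * N)) := by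
    have hn : ‖y1‖ = 1 / (2 * N) := by
      rw [hy1, show ‖EuclideanSpace.single (1 : Fin 3) (1 / (2 * N) : ℝ)‖ = ‖(1 / (2 * N) : ℝ)‖ by simp,
        Real.norm_eq_abs, abs_of_pos h2N]
    rw [edist_dist, dist_eq_norm, zero_sub, norm_neg, hn]
  refine le_iInf₂ fun C hC => ?_
  have h := hC 0 y1
  rw [hdist, ENNReal.ofReal_rpow_of_pos h2N, edist_dist, dist_eq_norm] at h
  have h4 : ENNReal.ofReal (4 * Real.pi * N) ≤ C * ENNReal.ofReal ((1 / (2 * N)) ^ (κ : ℝ)) :=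
    (ENNReal.ofReal_le_ofReal hgap).trans h
  have hcancel : ENNReal.ofReal ((1 / (2 * N) : ℝ) ^ (κ : ℝ)) * ENNReal.ofReal ((2 * N : ℝ) ^ (κ : ℝ)) = 1 := by
    rw [← ENNReal.ofReal_mul (Real.rpow_nonneg h2N.le _), ← Real.mul_rpow h2N.le (by positivity)]
    rw [show (1 / (2 * N) * (2 * N) : ℝ) = 1 by field_simp, Real.one_rpow, ENNReal.ofReal_one]
  calc ENNReal.ofReal (4 * Real.pi * N * (2 * N : ℝ) ^ (κ : ℝ))
      = ENNReal.ofReal (4 * Real.pi * N) * ENNReal.ofReal ((2 * N : ℝ) ^ (κ : ℝ)) :=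
        ENNReal.ofReal_mul (by positivity)
    _ ≤ C * ENNReal.ofReal ((1 / (2 * N)) ^ (κ : ℝ)) * ENNReal.ofReal ((2 * N : ℝ) ^ (κ : ℝ)) :=
        mul_le_mul' h4 le_rfl
    _ = C := by rw [mul_assoc, hcancel, mul_one]

/-- **Lower bound for the Hölder seminorm of `D(v(t) ∘ proj)`**:
`[D(v(t)∘proj)]_κ ≥ |a(t)| · 4πN (2N)^κ`. [folklore] -/
theorem le_eHolderNorm_iteratedFDeriv_one_lift_vel {N : ℕ} (hN : 0 < N) (κ : ℝ≥0) (A₀ s₀ t : ℝ) :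
    ENNReal.ofReal (|amp N A₀ s₀ t| * (4 * Real.pi * N * (2 * N : ℝ) ^ (κ : ℝ))) ≤
      eHolderNorm κ (iteratedFDeriv ℝ 1 (lift (vel N A₀ s₀ t))) := by
  have h : iteratedFDeriv ℝ 1 (lift (vel N A₀ s₀ t)) = amp N A₀ s₀ t • iteratedFDeriv ℝ 1 (lift (PulsedShear.profile N)) := by
    have h1 : lift (vel N A₀ s₀ t) = amp N A₀ s₀ t • lift (PulsedShear.profile N) := rfl
    funext y
    rw [h1, Pi.smul_apply]
    exact iteratedFDeriv_const_smul_apply (((isSmooth_profile N).of_le (mod_cast le_top)).contDiffAt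
      (n := ((1 : ℕ) : WithTop ℕ∞)))
  rw [h, eHolderNorm_smul, ENNReal.ofReal_mul (abs_nonneg _), ← ENNReal.ofReal_coe_nnreal,
    coe_nnnorm, Real.norm_eq_abs]
  exact mul_le_mul' le_rfl (le_eHolderNorm_iteratedFDeriv_one_lift_profile hN κ)

/-- The critical time `t_* = (2πN)^{-2}` of the mode, at which `|a(t_*)| = 2πN A₀ / e`. [folklore] -/
def tstar (N : ℕ) : ℝ := ((2 * Real.pi * N) ^ 2)⁻¹

/-- `t_* > 0`. [folklore] -/
theorem tstar_pos {N : ℕ} (hN : 0 < N) : 0 < tstar N := by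
  unfold tstar; positivity

/-- `t_* ≤ T_* = (4π²)⁻¹` (`N ≥ 1`). [folklore] -/
theorem tstar_le_unitTime {N : ℕ} (hN : 0 < N) : tstar N ≤ unitTime := by
  rw [tstar, unitTime_def]
  have hN1 : (1 : ℝ) ≤ N := by exact_mod_cast hN
  refine inv_anti₀ (by positivity) ?_
  have h := mul_le_mul_of_nonneg_left (show (1 : ℝ) ≤ (N : ℝ) ^ 2 by nlinarith)
    (show (0 : ℝ) ≤ 4 * Real.pi ^ 2 by positivity)
  calc 4 * Real.pi ^ 2 = 4 * Real.pi ^ 2 * 1 := by ring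
    _ ≤ 4 * Real.pi ^ 2 * (N : ℝ) ^ 2 := h
    _ = (2 * Real.pi * N) ^ 2 := by ring

/-- `E(t_*) = e⁻¹`. [folklore] -/
theorem decay_tstar {N : ℕ} (hN : 0 < N) : decay N (tstar N) = Real.exp (-1) := by
  rw [decay, tstar]
  congr 1
  field_simp
  ring

/-- `|a(t_*)| ≥ 2πN A₀ / 3` once the pulse is over by then (`2 s₀ ≤ t_*`). [folklore] -/
theorem abs_amp_tstar_ge {N : ℕ} (hN : 0 < N) {A₀ s₀ : ℝ} (hA : 0 ≤ A₀) (hs : 0 < s₀)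
    (h2s : 2 * s₀ ≤ tstar N) : 2 * Real.pi * N * A₀ / 3 ≤ |amp N A₀ s₀ (tstar N)| := by
  rw [amp_of_ge N A₀ hs h2s, decay_tstar hN, abs_mul, abs_neg, abs_of_nonneg (by positivity),
    abs_of_pos (Real.exp_pos _)]
  have he : (1 : ℝ) / 3 ≤ Real.exp (-1) := by
    rw [Real.exp_neg, one_div]
    exact inv_anti₀ (Real.exp_pos _) Real.exp_one_lt_three.le
  have h0 : 0 ≤ 2 * Real.pi * N * A₀ := by positivity
  calc 2 * Real.pi * N * A₀ / 3 = 2 * Real.pi * N * A₀ * (1 / 3) := by ring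
    _ ≤ 2 * Real.pi * N * A₀ * Real.exp (-1) := mul_le_mul_of_nonneg_left he h0

end Shear

end CoiculescuPalasek2025

/-! ## The refutation -/

section Refutation

open CoiculescuPalasek2025 CoiculescuPalasek2025.Shear
open Literature.Analysis.FunctionSpaces Literature.Analysis.FunctionSpaces.Torus
open Literature.Analysis.FluidPDE Literature.Analysis.FluidPDE.PulsedShear

/-- Powers of `N` collected: `N^{-31/16} · N · N^{-3/20} · N · N^{1/5} = N^{9/80}`. [folklore] -/
theorem rpow_collect_nine_eightieths {x : ℝ} (hx : 0 < x) :
    x ^ (-(31 / 16 : ℝ)) * (x * (x ^ (-(3 / 20 : ℝ)) * (x * x ^ (1 / 5 : ℝ)))) = x ^ (9 / 80 : ℝ) := by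
  have h : x * (x ^ (-(3 / 20 : ℝ)) * (x * x ^ (1 / 5 : ℝ))) =
      x ^ (1 : ℝ) * (x ^ (-(3 / 20 : ℝ)) * (x ^ (1 : ℝ) * x ^ (1 / 5 : ℝ))) := by
    rw [Real.rpow_one]
  rw [h, ← Real.rpow_add hx, ← Real.rpow_add hx, ← Real.rpow_add hx, ← Real.rpow_add hx]
  norm_num

-- names the `@[deprecated]` record `CoiculescuPalasek2025_perturbation` (`…Construction`) on
-- purpose: this IS the refutation of that statement, which keeps the record alive (verdict
-- clean-up 2026-08-16); REMOVE-WHEN the record is deleted from `…Construction` (then restate this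
-- theorem over the unfolded statement).
set_option linter.deprecated false in
/-- **The perturbation fact `CoiculescuPalasek2025_perturbation` is false as stated.**

The named fact abstracts Props. 4.2–4.3 of Coiculescu–Palasek to ALL approximate solutions and ALL
Hölder exponents `κ ∈ (0, 1/2 - 4α)`; the printed proof of Prop. 4.2 only yields the `∇`-slot of
the semigroup bound with the weight `t^{-(1+κ)/2}` (arXiv v. p. 19, the function
`h(t) = (t-t')^{1/2} t^{(1+κ)/2}‖∇S(t,t')‖_{C^κ}`), so that Prop. 4.3 closes in `X` only for
`κ ≤ α`, and for `κ(1-2α) > α` the abstraction fails. Refutation with `α = 1/16`, `κ = 1/5`,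
`K m = 6(m+1)!`, `C = 6`: given `C₄` take `ε₁ = min(C₄⁻¹/2, 1/40)`; given `ε₀, η` take
`δ = min(10⁻³, ε₀/(400R))` (`|ρ'| ≤ R`), `N` large, `s₀ = N^{-12/5}`, `A₀ = δ N^{-3/20}`, and the
forced shear flow `(v, F, 0)` of this file, an approximate solution with these data
(`Shear.isApproximateSolution`: `A₀ R s₀^{-α}(2 + 200 s₀^{1/2}N^{6/5}) = 202 δ R ≤ ε₀`). If `(w, q)`
were as in the conclusion, `u = v + w` would be a mean-zero classical solution of the unforced
equations on `(0, T_*]` with `‖u(t,x)‖ ≤ (14δ + ε₁) t^{-15/32}` (`Shear.norm_vel_le` and clause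
(c)) and weakly vanishing datum (`v ≡ 0` on `(0, s₀]` and clause (e)), hence `u ≡ 0` by the
Kato-class uniqueness theorem `Torus.IsClassicalNSSolutionOn.eq_zero_of_kato_of_pairing`
(`(1/20)² · 36² < 4`); so `w(t_*) = -v(t_*)` at `t_* = (2πN)^{-2} ∈ (0, T_*]`, and clause (d)
there, `t_*^{31/32} [∇w(t_*)]_{1/5} ≤ ε₁ ≤ 1/40`, contradicts the lower bound
`t_*^{31/32} |a(t_*)| 4πN (2N)^{1/5} ≥ c₀ δ N^{9/80} > 1`
(`Shear.le_eHolderNorm_iteratedFDeriv_one_lift_vel`, `Shear.abs_amp_tstar_ge`; the exponent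
`9/80 = κ(1-2α) - α` scaled). See the module docstring for the provenance and the corrected
statement. [cite: CoiculescuPalasek2025, Props. 4.2–4.3 (refutation of the over-generalised abstraction)] -/
theorem not_CoiculescuPalasek2025_perturbation : ¬ CoiculescuPalasek2025_perturbation := by
  intro hP
  obtain ⟨R, hR1, hR⟩ := exists_bumpDeriv_le
  have hR0 : 0 < R := by linarith
  -- exponents `α = 1/16`, `κ = 1/5`
  have hα0 : (0 : ℝ) < 1 / 16 := by norm_num
  have hα8 : (1 / 16 : ℝ) < 1 / 8 := by norm_num
  set κ : ℝ≥0 := ⟨1 / 5, by norm_num⟩ with hκdef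
  have hκR : (κ : ℝ) = 1 / 5 := rfl
  have hκ0 : 0 < κ := by
    rw [← NNReal.coe_pos, hκR]; norm_num
  have hκ1 : (κ : ℝ) < 1 / 2 - 4 * (1 / 16) := by rw [hκR]; norm_num
  have hκle : κ ≤ 1 := by
    rw [← NNReal.coe_le_coe, hκR]; norm_num
  obtain ⟨C₄, hC₄, hmain⟩ :=
    hP (1 / 16) hα0 hα8 κ hκ0 hκ1 (fun m => 6 * ((m + 1).factorial : ℝ)) 6
  -- `ε₁`
  set ε₁ : ℝ := min (C₄⁻¹ / 2) (1 / 40) with hε₁def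
  have hC₄i : 0 < C₄⁻¹ := inv_pos.2 hC₄
  have hε₁0 : 0 < ε₁ := lt_min (by positivity) (by norm_num)
  have hε₁C : ε₁ < C₄⁻¹ := (min_le_left _ _).trans_lt (by linarith)
  have hε₁s : ε₁ ≤ 1 / 40 := min_le_right _ _
  obtain ⟨ε₀, hε₀, η, hη, hall⟩ := hmain ε₁ hε₁0 hε₁C
  -- `δ`
  set δ : ℝ := min (1 / 1000) (ε₀ / (400 * R)) with hδdef
  have hδ0 : 0 < δ := lt_min (by norm_num) (by positivity)
  have hδ1 : δ ≤ 1 / 1000 := min_le_left _ _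
  have hδε : 400 * R * δ ≤ ε₀ := by
    have h1 : δ ≤ ε₀ / (400 * R) := min_le_right _ _
    have h2 : 0 < 400 * R := by positivity
    calc 400 * R * δ ≤ 400 * R * (ε₀ / (400 * R)) := mul_le_mul_of_nonneg_left h1 h2.le
      _ = ε₀ := by field_simp
  -- the constant of the lower bound and the choice of `N`
  set c₀ : ℝ := (2 * Real.pi) ^ (-(31 / 16 : ℝ)) * (2 * Real.pi / 3) * (4 * Real.pi) * (2 : ℝ) ^ (1 / 5 : ℝ)
    with hc₀def
  have hc₀ : 0 < c₀ := by positivity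
  have e1 : ∀ᶠ N : ℕ in atTop, 1 ≤ N := eventually_ge_atTop 1
  have e2 : ∀ᶠ N : ℕ in atTop, 8 * Real.pi ^ 2 ≤ (N : ℝ) ^ (2 / 5 : ℝ) := by
    have h1 : Tendsto (fun N : ℕ => (N : ℝ) ^ (2 / 5 : ℝ)) atTop atTop :=
      (tendsto_rpow_atTop (by norm_num)).comp tendsto_natCast_atTop_atTop
    exact h1.eventually_ge_atTop _
  have e3 : ∀ᶠ N : ℕ in atTop, 1 < c₀ * δ * (N : ℝ) ^ (9 / 80 : ℝ) := by
    have h0 : Tendsto (fun N : ℕ => (N : ℝ) ^ (9 / 80 : ℝ)) atTop atTop :=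
      (tendsto_rpow_atTop (by norm_num)).comp tendsto_natCast_atTop_atTop
    have h1 : Tendsto (fun N : ℕ => c₀ * δ * (N : ℝ) ^ (9 / 80 : ℝ)) atTop atTop :=
      h0.const_mul_atTop (mul_pos hc₀ hδ0)
    exact h1.eventually_gt_atTop _
  obtain ⟨N, hN1, hN2, hN3⟩ := (e1.and (e2.and e3)).exists
  have hN : 0 < N := hN1
  have hN' : (0 : ℝ) < N := Nat.cast_pos.2 hN
  have hN1' : (1 : ℝ) ≤ N := by exact_mod_cast hN1
  -- parameters of the shear flow
  set s₀ : ℝ := (N : ℝ) ^ (-(12 / 5 : ℝ)) with hs₀def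
  set A₀ : ℝ := δ * (N : ℝ) ^ (-(3 / 20 : ℝ)) with hA₀def
  have hs : 0 < s₀ := Real.rpow_pos_of_pos hN' _
  have hNpow_le : ∀ {e : ℝ}, e ≤ 0 → (N : ℝ) ^ e ≤ 1 := fun he =>
    Real.rpow_le_one_of_one_le_of_nonpos hN1' he
  have hA : 0 < A₀ := mul_pos hδ0 (Real.rpow_pos_of_pos hN' _)
  have hA1 : A₀ ≤ 1 := by
    calc A₀ ≤ 1 / 1000 * 1 := mul_le_mul hδ1 (hNpow_le (by norm_num)) (Real.rpow_nonneg hN'.le _)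
          (by norm_num)
      _ ≤ 1 := by norm_num
  -- `2 s₀ ≤ t_*`
  have h2s : 2 * s₀ ≤ tstar N := by
    rw [tstar, le_inv_comm₀ (by positivity) (by positivity)]
    -- `(2πN)² ≤ (2 s₀)⁻¹ = N^{12/5}/2`
    have h12 : (N : ℝ) ^ (12 / 5 : ℝ) = (N : ℝ) ^ (2 / 5 : ℝ) * (N : ℝ) ^ 2 := by
      rw [← Real.rpow_natCast _ 2, ← Real.rpow_add hN']; norm_num
    have hinv : (2 * s₀)⁻¹ = (N : ℝ) ^ (12 / 5 : ℝ) / 2 := by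
      rw [hs₀def, Real.rpow_neg hN'.le, mul_inv, inv_inv]; ring
    rw [hinv, h12, le_div_iff₀ (by norm_num : (0 : ℝ) < 2)]
    nlinarith [hN2, sq_nonneg (N : ℝ), Real.pi_pos]
  -- the residual size: `A₀ R s₀^{-1/16} (2 + 200 s₀^{1/2} N^{6/5}) = 202 δ R ≤ ε₀`
  have hAs : A₀ * s₀ ^ (-(1 / 16 : ℝ)) = δ := by
    rw [hA₀def, hs₀def, ← Real.rpow_mul hN'.le, mul_assoc, ← Real.rpow_add hN']
    norm_num
  have hsN : s₀ ^ (1 / 2 : ℝ) * (N : ℝ) ^ (1 + (κ : ℝ)) = 1 := by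
    rw [hs₀def, hκR, ← Real.rpow_mul hN'.le, ← Real.rpow_add hN']
    norm_num
  have hε : A₀ * R * s₀ ^ (-(1 / 16 : ℝ)) * (2 + 200 * (s₀ ^ (1 / 2 : ℝ) * (N : ℝ) ^ (1 + (κ : ℝ)))) ≤ ε₀ := by
    rw [hsN, show A₀ * R * s₀ ^ (-(1 / 16 : ℝ)) = (A₀ * s₀ ^ (-(1 / 16 : ℝ))) * R by ring, hAs]
    nlinarith [hδε, hδ0, hR0]
  -- the approximate solution and the claimed correction
  have happ := isApproximateSolution hN hA hA1 hs hR hα0.le (by norm_num) hκle hη.le hε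
  obtain ⟨w, q, hsol, hwm, hwc, hwd, _, hwp⟩ := hall _ _ _ happ
  -- Kato-class uniqueness for `u = v + w`
  set β : ℝ := (1 - 1 / 16) / 2 with hβdef
  have hβ0 : 0 ≤ β := by rw [hβdef]; norm_num
  have hβ2 : 2 * β < 1 := by rw [hβdef]; norm_num
  have hβ1 : β ≤ 1 := by rw [hβdef]; norm_num
  set M : ℝ := 2 * A₀ * (2 * Real.pi * N) ^ (1 - 2 * β) + ε₁ with hMdef
  have hvw : ∀ t x, (vel N A₀ s₀ + w) t x = vel N A₀ s₀ t x + w t x := fun t x => rfl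
  have hMbd : ∀ τ ∈ Ioc 0 unitTime, ∀ x, ‖(vel N A₀ s₀ + w) τ x‖ ≤ M * τ ^ (-β) := by
    intro τ hτ x
    have h1 := norm_vel_le N hA.le s₀ hβ0 hβ1 hτ.1 x
    have h2 : ‖w τ x‖ ≤ ε₁ * τ ^ (-β) := by
      have h3 := hwc τ hτ x
      have hτβ : 0 < τ ^ ((1 - 1 / 16) / 2 : ℝ) := Real.rpow_pos_of_pos hτ.1 _
      rw [hβdef, Real.rpow_neg hτ.1.le, ← div_eq_mul_inv, le_div_iff₀ hτβ, mul_comm]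
      exact h3
    rw [hvw]
    calc ‖vel N A₀ s₀ τ x + w τ x‖ ≤ ‖vel N A₀ s₀ τ x‖ + ‖w τ x‖ := norm_add_le _ _
      _ ≤ 2 * A₀ * (2 * Real.pi * N) ^ (1 - 2 * β) * τ ^ (-β) + ε₁ * τ ^ (-β) := add_le_add h1 h2
      _ = M * τ ^ (-β) := by rw [hMdef]; ring
  have hmeanu : ∀ t ∈ Ioc 0 unitTime, HasZeroMean ((vel N A₀ s₀ + w) t) := by
    intro t ht
    have hcu : Continuous ((vel N A₀ s₀ + w) t) := (hsol.smooth_velocity.isSmooth_slice ht).continuous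
    have hcv : Continuous (vel N A₀ s₀ t) := ((isSmoothSpaceTimeOn_vel N A₀ s₀ (Ioc 0 unitTime)).isSmooth_slice ht).continuous
    have hcw : Continuous (w t) := by
      have : w t = (vel N A₀ s₀ + w) t - vel N A₀ s₀ t := by
        funext x; rw [Pi.sub_apply, hvw]; abel
      rw [this]
      exact hcu.sub hcv
    unfold HasZeroMean
    have h1 : (fun x => (vel N A₀ s₀ + w) t x) = fun x => vel N A₀ s₀ t x + w t x := funext (hvw t)
    rw [show (∫ x, (vel N A₀ s₀ + w) t x) = ∫ x, (vel N A₀ s₀ t x + w t x) from rfl,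
      integral_add hcv.integrable_unitAddTorus hcw.integrable_unitAddTorus]
    have hv0 : ∫ x, vel N A₀ s₀ t x = 0 := hasZeroMean_vel hN A₀ s₀ t
    have hw0 : ∫ x, w t x = 0 := hwm t ht
    rw [hv0, hw0, add_zero]
  have hlimu : ∀ φ : UnitAddTorus (Fin 3) → EuclideanSpace ℝ (Fin 3), IsSmooth φ → HasZeroMean φ →
      Tendsto (fun t => ∫ x, ⟪(vel N A₀ s₀ + w) t x, φ x⟫) (𝓝[>] 0) (𝓝 0) := by
    intro φ hφ hφ0
    refine (hwp φ hφ hφ0).congr' ?_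
    filter_upwards [Ioo_mem_nhdsGT hs] with t ht
    refine integral_congr_ae (ae_of_all _ fun x => ?_)
    dsimp only
    rw [hvw, vel_of_le N A₀ hs ht.2.le]
    simp
  have hsmall : M ^ 2 * (2 / (1 - 2 * β) + 4) ^ 2 * unitTime ^ (1 - 2 * β) < 4 * (1 : ℝ) := by
    have hM0 : 0 ≤ M := by positivity
    have hMle : M ≤ 1 / 20 := by
      -- `A₀ (2πN)^{1/16} = δ (2π)^{1/16} N^{-7/80} ≤ 7δ`
      have hexp : (1 : ℝ) - 2 * β = 1 / 16 := by rw [hβdef]; norm_num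
      have h2π : (2 * Real.pi : ℝ) ^ (1 / 16 : ℝ) ≤ 7 := by
        have h1 : (1 : ℝ) ≤ 2 * Real.pi := by linarith [Real.pi_gt_three]
        calc (2 * Real.pi : ℝ) ^ (1 / 16 : ℝ) ≤ (2 * Real.pi) ^ (1 : ℝ) :=
              Real.rpow_le_rpow_of_exponent_le h1 (by norm_num)
          _ = 2 * Real.pi := Real.rpow_one _
          _ ≤ 7 := by linarith [Real.pi_lt_d2]
      have hAN : A₀ * (2 * Real.pi * N) ^ (1 / 16 : ℝ) ≤ 7 * δ := by
        rw [Real.mul_rpow (by positivity) hN'.le, hA₀def]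
        have hNN : (N : ℝ) ^ (-(3 / 20 : ℝ)) * (N : ℝ) ^ (1 / 16 : ℝ) ≤ 1 := by
          rw [← Real.rpow_add hN']
          exact hNpow_le (by norm_num)
        calc δ * (N : ℝ) ^ (-(3 / 20 : ℝ)) * ((2 * Real.pi) ^ (1 / 16 : ℝ) * (N : ℝ) ^ (1 / 16 : ℝ))
            = δ * (2 * Real.pi) ^ (1 / 16 : ℝ) * ((N : ℝ) ^ (-(3 / 20 : ℝ)) * (N : ℝ) ^ (1 / 16 : ℝ)) := by ring
          _ ≤ δ * 7 * 1 := by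
              refine mul_le_mul (mul_le_mul_of_nonneg_left h2π hδ0.le) hNN (by positivity) (by positivity)
          _ = 7 * δ := by ring
      rw [hMdef, hexp]
      nlinarith [hAN, hδ1, hε₁s]
    have hM2 : M ^ 2 ≤ (1 / 20) ^ 2 := pow_le_pow_left₀ hM0 hMle 2
    have hC : (2 / (1 - 2 * β) + 4 : ℝ) ^ 2 = 1296 := by rw [hβdef]; norm_num
    have hT : unitTime ^ (1 - 2 * β) ≤ 1 :=
      Real.rpow_le_one unitTime_pos.le unitTime_le_one (by rw [hβdef]; norm_num)
    have hT0 : 0 ≤ unitTime ^ (1 - 2 * β) := Real.rpow_nonneg unitTime_pos.le _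
    calc M ^ 2 * (2 / (1 - 2 * β) + 4) ^ 2 * unitTime ^ (1 - 2 * β)
        ≤ (1 / 20) ^ 2 * 1296 * 1 := by
          rw [hC]
          exact mul_le_mul (mul_le_mul_of_nonneg_right hM2 (by norm_num)) hT hT0 (by positivity)
      _ < 4 * 1 := by norm_num
  have hzero := hsol.eq_zero_of_kato_of_pairing one_pos hmeanu hβ0 hβ2 hMbd hlimu hsmall
  -- at the critical time `t_*`
  have ht : tstar N ∈ Ioc 0 unitTime := ⟨tstar_pos hN, tstar_le_unitTime hN⟩
  have hwt : w (tstar N) = -vel N A₀ s₀ (tstar N) := by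
    have hz := hzero (tstar N) ht
    funext x
    have hzx := congrFun hz x
    rw [hvw, Pi.zero_apply] at hzx
    rw [Pi.neg_apply]
    exact eq_neg_of_add_eq_zero_right hzx
  -- clause (d) at `t_*` against the lower bound
  have hd := hwd (tstar N) ht
  have hneg : eHolderNorm κ (iteratedFDeriv ℝ 1 (lift (w (tstar N)))) =
      eHolderNorm κ (iteratedFDeriv ℝ 1 (lift (vel N A₀ s₀ (tstar N)))) := by
    have h1 : lift (w (tstar N)) = (-1 : ℝ) • lift (vel N A₀ s₀ (tstar N)) := by
      funext y; rw [Pi.smul_apply, lift_apply, lift_apply, hwt, Pi.neg_apply, neg_one_smul]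
    have h2 : iteratedFDeriv ℝ 1 (lift (w (tstar N))) =
        (-1 : ℝ) • iteratedFDeriv ℝ 1 (lift (vel N A₀ s₀ (tstar N))) := by
      funext y
      rw [h1, Pi.smul_apply]
      exact iteratedFDeriv_const_smul_apply
        ((((isSmoothSpaceTimeOn_vel N A₀ s₀ (Ioc 0 unitTime)).isSmooth_slice ht).of_le
          (mod_cast le_top)).contDiffAt (n := ((1 : ℕ) : WithTop ℕ∞)))
    rw [h2, eHolderNorm_smul, nnnorm_neg, nnnorm_one, ENNReal.coe_one, one_mul]
  rw [hneg] at hd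
  have hlow := le_eHolderNorm_iteratedFDeriv_one_lift_vel hN κ A₀ s₀ (tstar N)
  have hQ : ENNReal.ofReal (tstar N ^ (1 - 1 / 16 / 2 : ℝ) *
      (|amp N A₀ s₀ (tstar N)| * (4 * Real.pi * N * (2 * N : ℝ) ^ (κ : ℝ)))) ≤ ENNReal.ofReal ε₁ := by
    rw [ENNReal.ofReal_mul (Real.rpow_nonneg (tstar_pos hN).le _)]
    exact (mul_le_mul' le_rfl hlow).trans hd
  have hQr : tstar N ^ (1 - 1 / 16 / 2 : ℝ) *
      (|amp N A₀ s₀ (tstar N)| * (4 * Real.pi * N * (2 * N : ℝ) ^ (κ : ℝ))) ≤ ε₁ :=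
    (ENNReal.ofReal_le_ofReal_iff hε₁0.le).1 hQ
  -- the lower bound `≥ c₀ δ N^{9/80} > 1`
  have hamp := abs_amp_tstar_ge hN hA.le hs h2s
  have htpow : tstar N ^ (1 - 1 / 16 / 2 : ℝ) = (2 * Real.pi * N) ^ (-(31 / 16 : ℝ)) := by
    rw [tstar, Real.inv_rpow (by positivity), ← Real.rpow_natCast _ 2,
      ← Real.rpow_mul (by positivity), ← Real.rpow_neg (by positivity)]
    norm_num
  have hlb : c₀ * δ * (N : ℝ) ^ (9 / 80 : ℝ) ≤ tstar N ^ (1 - 1 / 16 / 2 : ℝ) *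
      (|amp N A₀ s₀ (tstar N)| * (4 * Real.pi * N * (2 * N : ℝ) ^ (κ : ℝ))) := by
    have h1 : tstar N ^ (1 - 1 / 16 / 2 : ℝ) * ((2 * Real.pi * N * A₀ / 3) * (4 * Real.pi * N * (2 * N : ℝ) ^ (κ : ℝ))) ≤
        tstar N ^ (1 - 1 / 16 / 2 : ℝ) * (|amp N A₀ s₀ (tstar N)| * (4 * Real.pi * N * (2 * N : ℝ) ^ (κ : ℝ))) :=
      mul_le_mul_of_nonneg_left (mul_le_mul_of_nonneg_right hamp (by positivity))
        (Real.rpow_nonneg (tstar_pos hN).le _)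
    refine le_trans (le_of_eq ?_) h1
    rw [htpow, hκR, Real.mul_rpow (by positivity) hN'.le, Real.mul_rpow (by positivity) hN'.le, hA₀def,
      hc₀def, ← rpow_collect_nine_eightieths hN']
    ring
  have : (1 : ℝ) < ε₁ := hN3.trans_le (hlb.trans hQr)
  linarith

end Refutation

end Literature.Barriers.NavierStokesRegularity

end
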